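import Mathlib
import Literature.Analysis.FluidPDE.NSCriticalClosureBesovKatoClass
import Literature.Analysis.FluidPDE.NSCriticalClosureBesovBounded
import Literature.Analysis.FluidPDE.NSLerayOseenRepresentation
import Literature.Analysis.FluidPDE.NSBoundedMildOseenRestart
import Literature.Analysis.FluidPDE.NSBoundedMildSmoothing
import Literature.Analysis.FluidPDE.KNSSTypeIRateMildBridge
import Literature.Analysis.FluidPDE.KNSSTypeIRateMildProofs
import Literature.Analysis.UnboundedOperators.HeatKernelBoundedData
import Literature.Analysis.FluidPDE.TypeIAncientMild
import Literature.Analysis.FluidPDE.KNSSProp41MildHolds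
import Literature.Analysis.FluidPDE.KNSSMildRegularityTime
import Literature.Analysis.FluidPDE.OseenHeatKernelBridge
import Literature.Analysis.FluidPDE.KNSSMildRegularity
import Literature.Analysis.FluidPDE.TaoQuantitativeTotalSpeed
import Literature.Analysis.FluidPDE.KNSSTypeIRateCompactnessProofs
import Literature.Analysis.FluidPDE.SpaceTimeCalculus
import Literature.Analysis.FunctionSpaces.ContDiffHolderOne
import Literature.Analysis.FunctionSpaces.SobolevImbeddingSup
import Literature.Analysis.FluidPDE.DerivativeHolderInterpolation
import Mathlib.Analysis.Calculus.UniformLimitsDeriv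
import Literature.Analysis.FluidPDE.NSLerayBlowupRateTopHolds
import Literature.Analysis.FluidPDE.DirectionDissipation
import Literature.Analysis.FluidPDE.OseenSlice
import Literature.Analysis.FluidPDE.KNSSTypeIRateLiouvilleHolds
import Literature.Analysis.FluidPDE.AxisymmetricHeatFlow
import Literature.Analysis.FluidPDE.OseenKernelLineIntegrals
import Literature.Analysis.UnboundedOperators.HeatKernelFourier
import Literature.Analysis.FluidPDE.OseenMildUniqueness
import Literature.Analysis.FluidPDE.LocalTypeILiouville
import Literature.Analysis.FluidPDE.LocalTypeICharacterization
import Literature.Analysis.FluidPDE.ChaeWolfRemovingDSSBounds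
import Literature.Analysis.FluidPDE.SereginSverakPressureLocalTypeI
import Literature.Analysis.FluidPDE.NSLerayExistenceR3Holds
import Mathlib.Analysis.SpecialFunctions.Pow.Real
import Literature.Analysis.FluidPDE.VectorCalculusProofs
import Mathlib.Analysis.SpecialFunctions.Pow.Deriv
import Literature.Analysis.FluidPDE.NSVorticityBKMContinuation
import Literature.Analysis.FluidPDE.VorticityFormulationHolds
import Literature.Analysis.FluidPDE.ConstantinDirectionDissipationCalculus
import Literature.Analysis.FluidPDE.LambFormCurlKernel
import Mathlib.MeasureTheory.Integral.MeanInequalities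
import Mathlib.Analysis.Convex.SpecificFunctions.Basic
import HarnessLib

/-!
# Giga–Miura 2011 via the Type-I zoom kit, file 1 of 2: singular zoom data, extraction of the ancient mild limit, the flexible zoom, slice-wise Liouville tools (re-homed proofs)

**Y. Giga, H. Miura, *On vorticity directions near singularities for the Navier–Stokes flows with infinite energy*, Comm. Math.
Phys. 303 (2011), Cor. 2.6 with Rmk. 2.7 (§2.1) [GigaMiura2011]: for a classical Leray–Hopf solution on `ℝ³ × [0,T)`, bounded on
every `[0,T']`, whose possible blow-up at `T` is of Type I, a square-integrable-in-time `L^∞` bound on the gradient of the vorticity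
direction over the top region `{|ω| > d}` excludes blow-up (`u` continues past `T`); and the `L^a_t L^b_x` member of the scaling-invariant
family `2/a + 3/b = 1` (Rmk. 2.8).**  The two named facts `Literature.Analysis.FluidPDE.gigaMiura2011_directionGradient_typeI`
(`GigaMiura2011DirectionGradientCriterion.lean`) and `…gigaMiura2011_directionGradient_LaLb_typeI` are PROVED in the tree by the
Navier–Stokes cell's Type-I zoom kit (Koch–Nadirashvili–Seregin–Šverák 2009 style rescaling at a singular point, extraction of a
bounded ancient mild limit, persistence of the direction-gradient hypothesis under the zoom, a Liouville theorem for ancient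
solutions with slice-wise parallel vorticity, contradiction) — until now Summits-side only
(`Summits/NavierStokesRegularity/NavierStokesRegularity/Theorems/ScaledTopAlignmentGigaMiuraDirectionGradient{,LaLb}Holds.lean`).
RE-HOMED into `Literature/` by the Hodge foundations lane (`lit-hodgefound`, prover p20, generation 39) as TWO files: verbatim
DECLARATION-LEVEL ports (the declarations the two discharges need, in dependency order; each Part header lists the declarations of
its source module that are NOT carried) of 26 Summits modules `Summits/NavierStokesRegularity/NavierStokesRegularity/Theorems/*.lean`,
namespaces `Summit.NavierStokesRegularity.NavierStokesRegularity.Theorems{,.…}` re-rooted to `Literature.Analysis.NavierStokesZoomKit{,.…}`;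
imports from `Literature/` and Mathlib only; no `sorry`, no new axiom, NO named fact (D-0026).  PROVENANCE CONVENTION: docstrings are
carried byte-for-byte; declarations the cell cites keep their cites; `[folklore]`-tagged and untagged declarations (the cell's own
lemmas) carry the Part's tag `[cite: <Key>, <loc> (source of the ARGUMENT implemented / context; this declaration is the cell's own
lemma, NOT a printed statement)]`, because the gate does not admit a public Literature theorem without a cite tag.  Sibling
Literature-side discharges of the same paper by another seat: `GigaMiura2011ScaledAlignmentTypeIHolds.lean`,
`GigaMiura2011ScaledAlignmentBlowupLimitHolds.lean`, `GigaMiura2011UnidirectionalVorticityHolds.lean` (their primed zoom lemmas are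
independent of this port; nothing here redeclares a tree name).

THIS FILE (1 of 2) ports: SqueezeCycleSingularZoomData, ScaledTopAlignmentTypeIZoomNonAlignedLimitOseenSlab, SqueezeCycleExtremalElementExistsRegularity, SqueezeCycleSingularZoomWindow, SqueezeCycleExtremalElementExistsExtraction, SqueezeCycleSingularZoomExtraction, ScaledTopAlignmentTypeIZoomNonAlignedLimitZoom, ScaledTopAlignmentFlexibleZoom, ScaledTopAlignmentFlexibleZoomLU, SymmetryModuliCountHelicalEndLiouvilleLineLiouvilleEnd, AncientLoadBearing, SymmetryModuliCountSymmetricLiouvilleSmallAtMinusInfinity.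
-/

noncomputable section

/-!
## Part 1 — port of `Summits/NavierStokesRegularity/NavierStokesRegularity/Theorems/SqueezeCycleSingularZoomData.lean` (6 declarations kept)

# The Type-I zoom sequence of a classical solution at a final-time point
# (route `SqueezeCycle`, item `SingularZoom`, stmt-NavierStokesRegularity-10573), I: global data

Helper file (theorems only). For `ν > 0`, `T > 0` and a classical solution `(u, p)` of
Navier–Stokes on `ℝ³ × [0, T)`, Leray–Hopf from its rapidly decaying datum:

* `oseen_eq_of_classical` — the **Oseen integral equation between positive times**,
  `u(t) = e^{ν(t-s)Δ}u(s) - B^ν_s(u,u)(t)` pointwise for `0 < s < t < T` (Lemarié-Rieusset 2016,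
  Thm. 6.1 / Fabes–Jones–Rivière 1972: the tree's
  `ae_eq_heatExtension_sub_oseenDuhamel_of_isMildNSSolutionOn` for the bounded finite-energy
  duality-mild field `u` (bounded on closed sub-strips by `exists_forall_norm_le_of_tao2011`),
  restarted at `s` by `oseenMild_restart_holds`, and upgraded from a.e. to everywhere by
  continuity of both sides);
* `oseen_eq_timeRescale_of_classical` — the same at unit viscosity for the normalised field
  `ũ(s, x) = ν⁻¹u(s/ν, x)` on `(0, νT)`;
* `typeIZoomSeq` facts — for the viscosity-normalising parabolic zooms
  `w_c = (cα) • u ∘ Φ_c`, `Φ_c(s, y) = (T + c²β s, x₀ + cR y)` (`α = R/ν`, `β = R²/ν`) about a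
  final-time point `(T, x₀)`: they are classical unit-viscosity solutions on the final windows
  `(-δ/(c²β), 0)`, jointly continuous with weakly divergence-free slices, satisfy the Oseen
  equation there (`oseen_smul_stPull`), and obey the common Type-I bound
  `‖w_c(s, y)‖ ≤ (αC/√β)/√(-s)` inherited from the rate `√(T-t)‖u(t,x)‖ ≤ C` on `(T-δ, T)`.

Not carried from this source module (not needed by the declarations re-homed here; their consumers are Summits-side): `oseen_eq_of_classical`, `oseen_eq_timeRescale_of_classical`, `zoom_oseen`, `zoom_scaledEnergy_le`.
-/

section Part1

open _root_.MeasureTheory _root_.Set _root_.Function _root_.Filter _root_.TopologicalSpace _root_.Metric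
open scoped _root_.Topology _root_.NNReal _root_.ENNReal _root_.InnerProductSpace RealInnerProductSpace

namespace Literature.Analysis.NavierStokesZoomKit

open Literature.Analysis Literature.Analysis.FluidPDE

section Oseen

variable {ν T : ℝ} {u : ℝ → EuclideanSpace ℝ (Fin 3) → EuclideanSpace ℝ (Fin 3)}
  {p : ℝ → EuclideanSpace ℝ (Fin 3) → ℝ}

end Oseen

/-! ### The viscosity-normalising zooms about a final-time point -/

section Zoom

variable {ν T : ℝ} {u : ℝ → EuclideanSpace ℝ (Fin 3) → EuclideanSpace ℝ (Fin 3)}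
  {p : ℝ → EuclideanSpace ℝ (Fin 3) → ℝ} {x₀ : EuclideanSpace ℝ (Fin 3)} {C δ R α β c : ℝ}

/-- Window bookkeeping: for `0 < c`, `0 < β`, `δ ≤ T` and `-δ/(c²β) < s < 0` the physical time
`T + c²β s` lies in `(T − δ, T) ⊆ [0, T)`. [folklore]
[cite: KochNadirashviliSereginSverak2009, §§2–3 (source of the Type-I rescaling / ancient mild limit argument this module implements; this declaration is the cell’s own lemma, NOT a printed statement)] -/
theorem zoom_time_mem (hc : 0 < c) (hβ : 0 < β) (hδT : δ ≤ T) {s : ℝ}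
    (hs : s ∈ Ioo (-(δ / (c ^ 2 * β))) 0) :
    T + c ^ 2 * β * s ∈ Ioo (T - δ) T ∧ T + c ^ 2 * β * s ∈ Ico 0 T := by
  have hcb : 0 < c ^ 2 * β := by positivity
  have h1 : -δ < c ^ 2 * β * s := by
    have := mul_lt_mul_of_pos_left hs.1 hcb
    rwa [mul_neg, mul_div_cancel₀ _ hcb.ne'] at this
  have h2 : c ^ 2 * β * s < 0 := mul_neg_of_pos_of_neg hcb hs.2
  exact ⟨⟨by linarith, by linarith⟩, ⟨by linarith, by linarith⟩⟩

/-- **The zoom is a classical unit-viscosity solution on its final window.** For a classical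
solution `(u, p)` with viscosity `ν > 0` on `[0, T)` and scales `0 < R`, `α = R/ν`, `β = R²/ν`,
`0 < c`, `δ ≤ T`, the pair `w = (cα) • u ∘ Φ`, `q = (cα)² • p ∘ Φ`,
`Φ(s, y) = (T + c²β s, x₀ + cR y)`, is a classical solution of the unforced unit-viscosity system
on the window `(−δ/(c²β), 0)` (Leray's similarity transformation,
`IsClassicalNSSolutionOn.stRescale`). [cite: Leray1934, §20] -/
theorem zoom_isClassical (hν : 0 < ν) (hsol : IsClassicalNSSolutionOn (Ico 0 T) ν 0 u p)
    (hR : 0 < R) (hα : α = R / ν) (hβ : β = R ^ 2 / ν) (hc : 0 < c) (hδT : δ ≤ T) :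
    IsClassicalNSSolutionOn (Ioo (-(δ / (c ^ 2 * β))) 0) 1 0
      ((c * α) • stPull (c ^ 2 * β) (c * R) T x₀ u)
      ((c * α) ^ 2 • stPull (c ^ 2 * β) (c * R) T x₀ p) := by
  have hαpos : 0 < α := by rw [hα]; positivity
  have hβpos : 0 < β := by rw [hβ]; positivity
  have hβ' : c ^ 2 * β = (c * α) * (c * R) := by rw [hβ, hα]; field_simp
  have key := hsol.stRescale (mul_pos hc hαpos) (mul_pos hc hR) hβ' T x₀
  have hvisc : c * α * ν / (c * R) = 1 := by
    rw [hα]; field_simp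
  have hforce : (((c * α) ^ 2 * (c * R)) • stPull (c ^ 2 * β) (c * R) T x₀
      (0 : ℝ → EuclideanSpace ℝ (Fin 3) → EuclideanSpace ℝ (Fin 3))) = 0 := by
    funext s y; simp [stPull]
  rw [hvisc, hforce] at key
  refine key.mono (fun s hs => ?_) isOpen_Ioo.uniqueDiffOn
  exact (zoom_time_mem (T := T) hc hβpos hδT hs).2

/-- The zoom is jointly continuous on its final window. [folklore]
[cite: KochNadirashviliSereginSverak2009, §§2–3 (source of the Type-I rescaling / ancient mild limit argument this module implements; this declaration is the cell’s own lemma, NOT a printed statement)] -/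
theorem zoom_continuousOn (hν : 0 < ν) (hsol : IsClassicalNSSolutionOn (Ico 0 T) ν 0 u p)
    (hR : 0 < R) (hα : α = R / ν) (hβ : β = R ^ 2 / ν) (hc : 0 < c) (hδT : δ ≤ T) :
    ContinuousOn (uncurry ((c * α) • stPull (c ^ 2 * β) (c * R) T x₀ u))
      (Ioo (-(δ / (c ^ 2 * β))) 0 ×ˢ univ) :=
  (zoom_isClassical (x₀ := x₀) hν hsol hR hα hβ hc hδT).smooth_velocity.continuousOn

/-- The slices of the zoom on its final window are weakly divergence free (they are `C¹` and
divergence free). [folklore]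
[cite: KochNadirashviliSereginSverak2009, §§2–3 (source of the Type-I rescaling / ancient mild limit argument this module implements; this declaration is the cell’s own lemma, NOT a printed statement)] -/
theorem zoom_isWeaklyDivFree (hν : 0 < ν) (hsol : IsClassicalNSSolutionOn (Ico 0 T) ν 0 u p)
    (hR : 0 < R) (hα : α = R / ν) (hβ : β = R ^ 2 / ν) (hc : 0 < c) (hδT : δ ≤ T) {s : ℝ}
    (hs : s ∈ Ioo (-(δ / (c ^ 2 * β))) 0) :
    IsWeaklyDivFree (((c * α) • stPull (c ^ 2 * β) (c * R) T x₀ u) s) := by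
  have h := zoom_isClassical (x₀ := x₀) hν hsol hR hα hβ hc hδT
  exact VectorCalculus.IsDivFree.isWeaklyDivFree_holds (h.divFree s hs)
    ((h.contDiff_velocity hs).of_le (by exact_mod_cast le_top))

/-- **The common Type-I bound of the zooms**: if `√(T − t)‖u(t, x)‖ ≤ C` on the window
`(T − δ, T)`, then on `(−δ/(c²β), 0)` the zoom obeys `‖w(s, y)‖ ≤ (αC/√β)/√(−s)`, a bound
independent of `c` (the rate is scale invariant; KNSS 2009, (1.4)). [cite: KochNadirashviliSereginSverak2009, (1.4) (arXiv p. 2)] -/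
theorem zoom_norm_le (hR : 0 < R) (hα : α = R / ν) (hβ : β = R ^ 2 / ν) (hν : 0 < ν)
    (hc : 0 < c) (hδT : δ ≤ T)
    (hrate : ∀ t ∈ Ioo (T - δ) T, ∀ x, Real.sqrt (T - t) * ‖u t x‖ ≤ C) {s : ℝ}
    (hs : s ∈ Ioo (-(δ / (c ^ 2 * β))) 0) (y : EuclideanSpace ℝ (Fin 3)) :
    ‖((c * α) • stPull (c ^ 2 * β) (c * R) T x₀ u) s y‖ ≤
      (α * C / Real.sqrt β) / Real.sqrt (-s) := by
  have hαpos : 0 < α := by rw [hα]; positivity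
  have hβpos : 0 < β := by rw [hβ]; positivity
  obtain ⟨htw, -⟩ := zoom_time_mem (T := T) hc hβpos hδT hs
  set t : ℝ := T + c ^ 2 * β * s with ht
  have hTt : T - t = c ^ 2 * β * (-s) := by rw [ht]; ring
  have hspos : 0 < -s := neg_pos.2 hs.2
  have hsq : Real.sqrt (T - t) = c * Real.sqrt β * Real.sqrt (-s) := by
    rw [hTt, Real.sqrt_mul (by positivity), Real.sqrt_mul (by positivity), Real.sqrt_sq hc.le]
  have hsqpos : 0 < Real.sqrt (T - t) := Real.sqrt_pos.2 (sub_pos.2 htw.2)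
  have hu : ‖u t (x₀ + (c * R) • y)‖ ≤ C / Real.sqrt (T - t) := by
    rw [le_div_iff₀ hsqpos, mul_comm]; exact hrate t htw _
  have hC : 0 ≤ C := le_trans (mul_nonneg (Real.sqrt_nonneg _) (norm_nonneg _)) (hrate t htw x₀)
  rw [smul_stPull_apply, norm_smul, Real.norm_eq_abs, abs_of_pos (mul_pos hc hαpos)]
  calc c * α * ‖u (T + c ^ 2 * β * s) (x₀ + (c * R) • y)‖
      ≤ c * α * (C / Real.sqrt (T - t)) := mul_le_mul_of_nonneg_left hu (by positivity)
    _ = (α * C / Real.sqrt β) / Real.sqrt (-s) := by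
        rw [hsq]
        field_simp

/-- **The zoom in terms of the viscosity-normalised field**: with `ũ = timeRescale ν⁻¹ ν⁻¹ u`,
`(cα) • u ∘ Φ = (cR) • stPull ((cR)²) (cR) (νT) x₀ ũ` (`α = R/ν`, `β = R²/ν`). [folklore]
[cite: KochNadirashviliSereginSverak2009, §§2–3 (source of the Type-I rescaling / ancient mild limit argument this module implements; this declaration is the cell’s own lemma, NOT a printed statement)] -/
theorem zoom_eq_smul_stPull_timeRescale (hν : 0 < ν) (hα : α = R / ν) (hβ : β = R ^ 2 / ν) :
    ((c * α) • stPull (c ^ 2 * β) (c * R) T x₀ u) =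
      (c * R) • stPull ((c * R) ^ 2) (c * R) (ν * T) x₀ (timeRescale ν⁻¹ ν⁻¹ u) := by
  have hν0 : ν ≠ 0 := hν.ne'
  funext s y
  rw [smul_stPull_apply, smul_stPull_apply, timeRescale_apply, smul_smul]
  congr 1
  · rw [hα]; field_simp
  · congr 1
    rw [hβ]; field_simp

end Zoom

end Literature.Analysis.NavierStokesZoomKit

end Part1

/-!
## Part 2 — port of `Summits/NavierStokesRegularity/NavierStokesRegularity/Theorems/ScaledTopAlignmentTypeIZoomNonAlignedLimitOseenSlab.lean` (3 declarations kept)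

# Route `ScaledTopAlignment`, crux GAP″ = `TypeIZoomNonAlignedLimit` (stmt-NavierStokesRegularity-19902):
# the Oseen integral equation of a classical Leray–Hopf solution bounded on closed sub-strips, and of
# its Type-I zooms about moving centres

Support file (theorems only) for the zoom step (p3's `stub_zoomProfile` / `stub_zoomSlices`) of the
crux `TypeIZoomNonAlignedLimit`. The crux is stated for classical Leray–Hopf solutions on `[0, T)`
with SLAB `L^∞` BOUNDS (`∀ T' < T, ∃ M, |u| ≤ M on [0, T'] × ℝ³`) and no decay hypothesis on the datum.
The tree's zoom data file `SqueezeCycleSingularZoomData` (item `SingularZoom`, stmt-10573) proves the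
Oseen integral equation `u(t) = e^{ν(t−s)Δ}u(s) − B^ν_s(u,u)(t)` between positive times
(`oseen_eq_of_classical`) and its transport to the viscosity-normalising zooms (`zoom_oseen`) for
solutions from a RAPIDLY DECAYING datum, the decay entering only through the slab bounds
(`exists_forall_norm_le_of_tao2011`). This file re-threads the same three proofs with the slab bounds
taken as a hypothesis:

* `oseen_eq_of_classical_of_slab` — Lemarié-Rieusset 2016, Thm. 6.1 / Fabes–Jones–Rivière 1972 (the
  tree's `ae_eq_heatExtension_sub_oseenDuhamel_of_isMildNSSolutionOn` for the bounded finite-energy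
  duality-mild field, restarted at `s` by `oseenMild_restart_holds`, a.e. upgraded to everywhere by
  continuity);
* `oseen_eq_timeRescale_of_classical_of_slab` — the same at unit viscosity for `ũ(s, x) = ν⁻¹u(s/ν, x)`;
* `zoom_oseen_of_slab` — the Oseen equation of the zooms `(cα) • u ∘ Φ`, `Φ(s, y) = (T + c²β s, x₀ + cR y)`
  (`α = R/ν`, `β = R²/ν`) on their final windows `(−δ/(c²β), 0)` (KNSS 2009, §1 (1.2)).

## References

* P. G. Lemarié-Rieusset, *The Navier–Stokes Problem in the 21st Century*, CRC 2016, Thm. 6.1,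
  Prop. 6.5. [LemarieRieusset2016]
* G. Koch, N. Nadirashvili, G. Seregin, V. Šverák, Acta Math. 203 (2009) 83–105, §1 (1.1)–(1.2), §4
  p. 8 (arXiv:0709.3599). [KochNadirashviliSereginSverak2009]
-/

section Part2

open _root_.MeasureTheory _root_.Set _root_.Function _root_.Filter _root_.TopologicalSpace _root_.Metric
open scoped _root_.Topology _root_.NNReal _root_.ENNReal _root_.InnerProductSpace RealInnerProductSpace

namespace Literature.Analysis.NavierStokesZoomKit

open Literature.Analysis Literature.Analysis.FluidPDE

section Oseen

variable {ν T : ℝ} {u : ℝ → EuclideanSpace ℝ (Fin 3) → EuclideanSpace ℝ (Fin 3)}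
  {p : ℝ → EuclideanSpace ℝ (Fin 3) → ℝ}

/-- **The Oseen integral equation of a classical Leray–Hopf solution bounded on closed sub-strips,
between positive times**: for `ν > 0`, `0 < T`, a classical solution on `ℝ³ × [0, T)`, Leray–Hopf
from `u 0`, bounded on every `[0, T₁] × ℝ³`, `T₁ < T`, and `0 < s < t < T`:
`u(t) = e^{ν(t−s)Δ}u(s) − B^ν_s(u, u)(t)` pointwise (the proof of the tree's `oseen_eq_of_classical`
with the slab bounds as a hypothesis in place of the rapid decay of the datum;
Lemarié-Rieusset 2016, Thm. 6.1 with Prop. 6.5; KNSS 2009, §4 p. 8 for the restart). [cite: LemarieRieusset2016, Thm. 6.1 with Prop. 6.5 (pp. 133–136)] -/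
theorem oseen_eq_of_classical_of_slab (hν : 0 < ν) (hT : 0 < T)
    (hsol : IsClassicalNSSolutionOn (Ico 0 T) ν 0 u p) (hLH : IsLerayHopfOn T ν 0 (u 0) u)
    (hbdd : ∀ T₁ ∈ Ioo 0 T, ∃ M : ℝ, ∀ t ∈ Icc 0 T₁, ∀ x, ‖u t x‖ ≤ M)
    {s t : ℝ} (hs : 0 < s) (hst : s < t) (htT : t < T)
    (x : EuclideanSpace ℝ (Fin 3)) :
    u t x = UnboundedOperators.heatExtension (u s) (ν * (t - s)) x - oseenDuhamel ν s u u t x := by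
  -- adapted from `oseen_eq_of_classical` (`SqueezeCycleSingularZoomData`), slab bounds as hypothesis
  have hcont : ContinuousOn (uncurry u) (Ico 0 T ×ˢ univ) := hsol.smooth_velocity.continuousOn
  have hmeasT : AEStronglyMeasurable (uncurry u) (volume.restrict (Ioo 0 T ×ˢ univ)) :=
    (hcont.mono (prod_mono Ioo_subset_Ico_self Subset.rfl)).aestronglyMeasurable
      (measurableSet_Ioo.prod MeasurableSet.univ)
  have hslc : ∀ τ ∈ Ico 0 T, Continuous (u τ) := fun τ hτ =>
    (hsol.contDiff_velocity hτ).continuous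
  have hsl : ∀ τ ∈ Ico 0 T, AEStronglyMeasurable (u τ) volume := fun τ hτ =>
    (hslc τ hτ).aestronglyMeasurable
  have hdiv0 : IsWeaklyDivFree (u 0) := hLH.isWeaklyDivFree_datum hT
  have hu02 : MemLp (u 0) 2 volume := hLH.memLp 0 ⟨le_rfl, hT.le⟩
  have hmildT : IsMildNSSolutionOn (Ioc 0 T) ν 0 (u 0) u :=
    isMildNSSolutionOn_of_isLerayHopfOn_holds hν hT hu02 hLH
  -- the representation from time `0`, a.e., at every `t ∈ (0, T)`
  have hrepr : ∀ τ ∈ Ioo 0 T, u τ =ᵐ[volume] fun y =>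
      UnboundedOperators.heatExtension (u 0) (ν * τ) y - oseenDuhamel ν 0 u u τ y := by
    intro τ hτ
    set T' : ℝ := (τ + T) / 2 with hT'
    have hT'0 : 0 < T' := by rw [hT']; linarith [hτ.1]
    have hτT' : τ < T' := by rw [hT']; linarith [hτ.2]
    have hT'T : T' < T := by rw [hT']; linarith [hτ.2]
    obtain ⟨M, hM⟩ := hbdd T' ⟨hT'0, hT'T⟩
    have hM' : ∀ σ ∈ Icc 0 T', ∀ y, ‖u σ y‖ ≤ max M 1 := fun σ hσ y =>
      (hM σ hσ y).trans (le_max_left _ _)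
    exact ae_eq_heatExtension_sub_oseenDuhamel_of_isMildNSSolutionOn hν hT'0
      (hmildT.mono (Ioc_subset_Ioc_right hT'T.le))
      (hmeasT.mono_measure (Measure.restrict_mono (prod_mono (Ioo_subset_Ioo_right hT'T.le)
        Subset.rfl) le_rfl))
      (fun σ hσ => hsl σ ⟨hσ.1, hσ.2.trans_lt hT'T⟩) (lt_of_lt_of_le one_pos (le_max_right _ _))
      hM' hdiv0 (fun σ hσ => hLH.memLp σ ⟨hσ.1, hσ.2.trans hT'T.le⟩) ⟨hτ.1, hτT'.le⟩
  -- uniform essential bounds on sub-strips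
  have hbounds : ∀ T₁ ∈ Ioo 0 T, ∃ C : ℝ≥0∞, C < ∞ ∧ ∀ τ ∈ Ico 0 T₁, eLpNorm (u τ) ∞ volume ≤ C := by
    intro T₁ hT₁
    obtain ⟨M, hM⟩ := hbdd T₁ hT₁
    refine ⟨ENNReal.ofReal M, ENNReal.ofReal_lt_top, fun τ hτ => ?_⟩
    rw [eLpNorm_exponent_top]
    exact eLpNormEssSup_le_of_ae_bound (Eventually.of_forall fun y => hM τ ⟨hτ.1, hτ.2.le⟩ y)
  -- restart at `s`, a.e.
  have hae : u t =ᵐ[volume] fun y =>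
      UnboundedOperators.heatExtension (u s) (ν * (t - s)) y - oseenDuhamel ν s u u t y :=
    oseenMild_restart_holds (EuclideanSpace ℝ (Fin 3)) hν hT hmeasT (hsl 0 ⟨le_rfl, hT⟩) hbounds
      hrepr hs hst htT
  -- both sides are continuous in `x`
  obtain ⟨M, hM⟩ := hbdd ((t + T) / 2) ⟨by linarith, by linarith⟩
  have hM0 : 0 ≤ M := (norm_nonneg _).trans (hM 0 ⟨le_rfl, by linarith⟩ 0)
  have hsI : s ∈ Ico 0 T := ⟨hs.le, hst.trans htT⟩
  have hheat : Continuous fun y => UnboundedOperators.heatExtension (u s) (ν * (t - s)) y :=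
    (UnboundedOperators.contDiff_heatExtension_of_bound (m := 0) (hslc s hsI)
      (fun z => hM s ⟨hs.le, by linarith⟩ z) (mul_pos hν (sub_pos.2 hst))).continuous
  have hmeas_st : AEStronglyMeasurable (uncurry u)
      ((volume : Measure (ℝ × EuclideanSpace ℝ (Fin 3))).restrict (Ioo s t ×ˢ univ)) :=
    hmeasT.mono_measure (Measure.restrict_mono
      (prod_mono (Ioo_subset_Ioo hs.le htT.le) Subset.rfl) le_rfl)
  have hbd_st : ∀ τ ∈ Ioo s t, ∀ y, ‖u τ y‖ ≤ M := fun τ hτ y =>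
    hM τ ⟨(hs.trans hτ.1).le, by linarith [hτ.2]⟩ y
  have hduh : Continuous (oseenDuhamel ν s u u t) :=
    continuous_oseenDuhamel_slice hν hM0 hmeas_st hmeas_st hbd_st hbd_st hst le_rfl
  have heq := (Continuous.ae_eq_iff_eq volume (hslc t ⟨hs.le.trans hst.le, htT⟩)
    (hheat.sub hduh)).1 hae
  exact congrFun heq x

/-- **The Oseen equation at unit viscosity for the normalised field** `ũ = timeRescale ν⁻¹ ν⁻¹ u`,
`ũ(s, x) = ν⁻¹u(s/ν, x)`, of a classical Leray–Hopf solution bounded on closed sub-strips: for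
`0 < σ < τ < νT`, `ũ(τ) = e^{(τ−σ)Δ}ũ(σ) − B¹_σ(ũ, ũ)(τ)` pointwise (KNSS 2009, §1 (1.1): `ν = 1`
by rescaling). [cite: KochNadirashviliSereginSverak2009, §1 (1.1) (arXiv p. 2)] -/
theorem oseen_eq_timeRescale_of_classical_of_slab (hν : 0 < ν) (hT : 0 < T)
    (hsol : IsClassicalNSSolutionOn (Ico 0 T) ν 0 u p) (hLH : IsLerayHopfOn T ν 0 (u 0) u)
    (hbdd : ∀ T₁ ∈ Ioo 0 T, ∃ M : ℝ, ∀ t ∈ Icc 0 T₁, ∀ x, ‖u t x‖ ≤ M)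
    {σ τ : ℝ} (hσ : 0 < σ) (hστ : σ < τ) (hτ : τ < ν * T)
    (x : EuclideanSpace ℝ (Fin 3)) :
    timeRescale ν⁻¹ ν⁻¹ u τ x =
      UnboundedOperators.heatExtension (timeRescale ν⁻¹ ν⁻¹ u σ) (τ - σ) x -
        oseenDuhamel 1 σ (timeRescale ν⁻¹ ν⁻¹ u) (timeRescale ν⁻¹ ν⁻¹ u) τ x := by
  -- adapted from `oseen_eq_timeRescale_of_classical` (`SqueezeCycleSingularZoomData`)
  have hν0 : ν ≠ 0 := hν.ne'
  obtain ⟨s, rfl⟩ : ∃ s, σ = ν * s := ⟨ν⁻¹ * σ, by field_simp⟩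
  obtain ⟨t, rfl⟩ : ∃ t, τ = ν * t := ⟨ν⁻¹ * τ, by field_simp⟩
  have hs : 0 < s := by
    rcases lt_or_ge 0 s with h | h
    · exact h
    · nlinarith
  have hst : s < t := lt_of_mul_lt_mul_left hστ hν.le
  have htT : t < T := lt_of_mul_lt_mul_left hτ hν.le
  rw [oseenDuhamel_one_timeRescale hν u hst.le x, timeRescale_apply, timeRescale_slice,
    UnboundedOperators.heatExtension_const_smul, show ν⁻¹ * (ν * t) = t by field_simp,
    show ν⁻¹ * (ν * s) = s by field_simp, show ν * t - ν * s = ν * (t - s) by ring, ← smul_sub,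
    oseen_eq_of_classical_of_slab hν hT hsol hLH hbdd hs hst htT x]

end Oseen

section Zoom

variable {ν T : ℝ} {u : ℝ → EuclideanSpace ℝ (Fin 3) → EuclideanSpace ℝ (Fin 3)}
  {p : ℝ → EuclideanSpace ℝ (Fin 3) → ℝ} {x₀ : EuclideanSpace ℝ (Fin 3)} {C δ R α β c : ℝ}

/-- **The Oseen integral equation of the zooms on their final windows**, for a classical Leray–Hopf
solution bounded on closed sub-strips (KNSS 2009, §1 (1.2): the rescaled solutions "are mild
solutions … for suitable re-scalings of the initial datum"): with `α = R/ν`, `β = R²/ν`, `0 < c`,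
`δ ≤ T`, the zoom `w = (cα) • u ∘ Φ`, `Φ(s, y) = (T + c²β s, x₀ + cR y)`, satisfies
`w(τ) = e^{(τ−σ)Δ}w(σ) − B¹_σ(w, w)(τ)` pointwise for `−δ/(c²β) < σ < τ < 0` (the proof of the tree's
`zoom_oseen` over `oseen_eq_timeRescale_of_classical_of_slab`). [cite: KochNadirashviliSereginSverak2009, §1 (1.2) and proof of Thm 6.2 (arXiv p. 13)] -/
theorem zoom_oseen_of_slab (hν : 0 < ν) (hT : 0 < T)
    (hsol : IsClassicalNSSolutionOn (Ico 0 T) ν 0 u p) (hLH : IsLerayHopfOn T ν 0 (u 0) u)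
    (hbdd : ∀ T₁ ∈ Ioo 0 T, ∃ M : ℝ, ∀ t ∈ Icc 0 T₁, ∀ x, ‖u t x‖ ≤ M)
    (hR : 0 < R) (hα : α = R / ν) (hβ : β = R ^ 2 / ν) (hc : 0 < c) (hδT : δ ≤ T) {σ τ : ℝ}
    (hσ : -(δ / (c ^ 2 * β)) < σ) (hστ : σ < τ) (hτ : τ < 0) (y : EuclideanSpace ℝ (Fin 3)) :
    ((c * α) • stPull (c ^ 2 * β) (c * R) T x₀ u) τ y =
      UnboundedOperators.heatExtension (((c * α) • stPull (c ^ 2 * β) (c * R) T x₀ u) σ) (τ - σ) y -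
        oseenDuhamel 1 σ ((c * α) • stPull (c ^ 2 * β) (c * R) T x₀ u)
          ((c * α) • stPull (c ^ 2 * β) (c * R) T x₀ u) τ y := by
  -- adapted from `zoom_oseen` (`SqueezeCycleSingularZoomData`)
  have hν0 : ν ≠ 0 := hν.ne'
  have hβpos : 0 < β := by rw [hβ]; positivity
  have hcR : 0 < c * R := mul_pos hc hR
  have hcb : (c * R) ^ 2 = ν * (c ^ 2 * β) := by rw [hβ]; field_simp
  have hσ' : 0 < ν * T + (c * R) ^ 2 * σ := by
    have hσs : σ ∈ Ioo (-(δ / (c ^ 2 * β))) 0 := ⟨hσ, hστ.trans hτ⟩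
    obtain ⟨-, hI⟩ := zoom_time_mem (T := T) hc hβpos hδT hσs
    have h1 : 0 ≤ T + c ^ 2 * β * σ := hI.1
    have h2 : -δ < c ^ 2 * β * σ := by
      have hcb' : 0 < c ^ 2 * β := by positivity
      have := mul_lt_mul_of_pos_left hσ hcb'
      rwa [mul_neg, mul_div_cancel₀ _ hcb'.ne'] at this
    rw [hcb, show ν * T + ν * (c ^ 2 * β) * σ = ν * (T + c ^ 2 * β * σ) by ring]
    refine mul_pos hν (lt_of_le_of_ne h1 fun h => ?_)
    have : c ^ 2 * β * σ = -T := by linarith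
    linarith
  have hτ' : ν * T + (c * R) ^ 2 * τ < ν * T := by
    have : (c * R) ^ 2 * τ < 0 := mul_neg_of_pos_of_neg (by positivity) hτ
    linarith
  have hστ' : ν * T + (c * R) ^ 2 * σ < ν * T + (c * R) ^ 2 * τ := by
    have := mul_lt_mul_of_pos_left hστ (show 0 < (c * R) ^ 2 by positivity)
    linarith
  rw [zoom_eq_smul_stPull_timeRescale (T := T) (x₀ := x₀) (u := u) (c := c) hν hα hβ]
  exact oseen_smul_stPull hcR (ν * T) x₀ hστ (fun X =>
    oseen_eq_timeRescale_of_classical_of_slab hν hT hsol hLH hbdd hσ' hστ' hτ' X) y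

end Zoom

end Literature.Analysis.NavierStokesZoomKit

end Part2

/-!
## Part 3 — port of `Summits/NavierStokesRegularity/NavierStokesRegularity/Theorems/SqueezeCycleExtremalElementExistsRegularity.lean` (6 declarations kept)

# Uniform regularity of continuous Type-I Oseen-mild ancient fields (route `SqueezeCycle`,
# item `ExtremalElementExists`, stmt-NavierStokesRegularity-11611)

Helper file for the compactness of the Type-I model class `𝒦_C` of route `SqueezeCycle`.
A field `u : ℝ → ℝ³ → ℝ³` which is jointly continuous on the open slab `(-∞, 0) × ℝ³`, has weakly
divergence-free slices, satisfies the Oseen integral equation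
`u t x = e^{(t-s)Δ}u(s)(x) - B¹_s(u,u)(t)(x)` for all `s < t < 0`, and obeys the Type-I bound
`‖u(t,x)‖ ≤ C/√(-t)`, is — after a time shift and a clamp — a restarted bounded mild field of
KNSS 2009, §4 on every window `(a, b)`, `a < b < 0` (`IsKNSSDriftMild`). Consequently
(KNSS 2009, Prop. 4.1 in the tree's rendering `KNSS2009_prop41_mild_holds`,
`KNSSBootstrap.exists_norm_iteratedFDeriv_slice_le`, `KNSSBootstrap.exists_lipschitz_time_iteratedFDeriv`):

* it is jointly `C^∞` on the slab, divergence free, hence a member of `IsTypeIAncientMild C`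
  (`isTypeIAncientMild_of_continuous_oseenMild`);
* for every order `k`, window `a < b < 0` and margin `δ > 0` there are constants, depending on
  `k, a, b, δ, C` only, bounding `‖Dᵏ u(t)(x)‖` on `[a + δ, b) × ℝ³` and the time-Lipschitz
  modulus of `Dᵏu(·)(x)` there, uniformly over all such fields with the same constant `C`
  (`exists_norm_iteratedFDeriv_le_of_typeI`, `exists_lipschitz_time_of_typeI`).

Not carried from this source module (not needed by the declarations re-homed here; their consumers are Summits-side): `exists_norm_iteratedFDeriv_le_of_typeI`, `exists_lipschitz_time_of_typeI`.
-/

section Part3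

open _root_.MeasureTheory _root_.Set _root_.Function _root_.Filter _root_.TopologicalSpace _root_.Metric
open scoped _root_.Topology _root_.NNReal _root_.ENNReal

namespace Literature.Analysis.NavierStokesZoomKit

open Literature.Analysis Literature.Analysis.FluidPDE

/-! ### The clamped, shifted window field -/

/-- The clamp `τ ↦ max a (min (τ + a) b)` is continuous, takes values in `[a, b]` (`a ≤ b`) and is
the shift `τ + a` for `τ ∈ [0, b - a]`. [folklore]
[cite: KochNadirashviliSereginSverak2009, §§2–3 (source of the Type-I rescaling / ancient mild limit argument this module implements; this declaration is the cell’s own lemma, NOT a printed statement)] -/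
theorem clampShift_facts {a b : ℝ} (hab : a ≤ b) :
    Continuous (fun τ : ℝ => max a (min (τ + a) b)) ∧
      (∀ τ : ℝ, max a (min (τ + a) b) ∈ Icc a b) ∧
      ∀ τ ∈ Icc 0 (b - a), max a (min (τ + a) b) = τ + a :=
  ⟨continuous_const.max ((continuous_id.add continuous_const).min continuous_const), fun τ =>
    ⟨le_max_left _ _, max_le hab (min_le_right _ _)⟩, fun τ hτ => by
    rw [min_eq_left (by linarith [hτ.2]), max_eq_right (by linarith [hτ.1])]⟩

/-- The Type-I constant of a field satisfying the Type-I bound at some negative time is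
nonnegative. [folklore]
[cite: KochNadirashviliSereginSverak2009, §§2–3 (source of the Type-I rescaling / ancient mild limit argument this module implements; this declaration is the cell’s own lemma, NOT a printed statement)] -/
theorem typeI_const_nonneg {C : ℝ} {u : ℝ → EuclideanSpace ℝ (Fin 3) → EuclideanSpace ℝ (Fin 3)}
    (hI : HasTypeITimeDecay C u) : 0 ≤ C := by
  have h := hI (-1) (by norm_num) 0
  rw [neg_neg, Real.sqrt_one, div_one] at h
  exact (norm_nonneg _).trans h

section Window

variable {C : ℝ} {u : ℝ → EuclideanSpace ℝ (Fin 3) → EuclideanSpace ℝ (Fin 3)}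

/-- **A continuous Type-I Oseen-mild ancient field is a restarted bounded mild field on every
window** (KNSS 2009, §4 (i)): for `a < b < 0` the clamped shift
`V τ x = u (max a (min (τ + a) b)) x` satisfies `IsKNSSDriftMild (b - a) (C/√(-b)) V 0` — jointly
measurable (continuous), bounded by `C/√(-b)` on the window, weakly divergence free, and
`V(t) = e^{(t−s)Δ}V(s) − ∫ₛᵗ e^{(t−σ)Δ}P∇·(V⊗V)` for `0 < s < t < b - a`
(`driftDuhamel_zero_eq_oseenDuhamel`, `oseenDuhamel_translate`). [cite: KochNadirashviliSereginSverak2009, §4 (i) (arXiv:0709.3599v1 p. 8)] -/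
theorem isKNSSDriftMild_window (hc : ContinuousOn (uncurry u) (Iio 0 ×ˢ univ))
    (hdiv : ∀ t < 0, IsWeaklyDivFree (u t))
    (hmild : ∀ s t : ℝ, s < t → t < 0 → ∀ x,
      u t x = UnboundedOperators.heatExtension (u s) (t - s) x - oseenDuhamel 1 s u u t x)
    (hI : HasTypeITimeDecay C u) {a b : ℝ} (hab : a < b) (hb : b < 0) :
    IsKNSSDriftMild (b - a) (C / Real.sqrt (-b)) (fun τ x => u (max a (min (τ + a) b)) x) 0 := by
  obtain ⟨hκc, hκmem, hκid⟩ := clampShift_facts hab.le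
  have hC : 0 ≤ C := typeI_const_nonneg hI
  have hN0 : 0 ≤ C / Real.sqrt (-b) := by positivity
  have hκneg : ∀ τ, max a (min (τ + a) b) < 0 := fun τ => (hκmem τ).2.trans_lt hb
  have hcont : Continuous (uncurry fun τ x => u (max a (min (τ + a) b)) x) := by
    have hmap : Continuous fun p : ℝ × EuclideanSpace ℝ (Fin 3) =>
        (max a (min (p.1 + a) b), p.2) :=
      (hκc.comp continuous_fst).prodMk continuous_snd
    have hinto : ∀ p : ℝ × EuclideanSpace ℝ (Fin 3),
        (max a (min (p.1 + a) b), p.2) ∈ Iio (0 : ℝ) ×ˢ (univ : Set (EuclideanSpace ℝ (Fin 3))) :=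
      fun p => ⟨hκneg p.1, mem_univ _⟩
    exact (hc.comp_continuous hmap hinto).congr fun p => rfl
  have hslice : ∀ t < 0, Continuous (u t) := fun t ht =>
    hc.comp_continuous (Continuous.prodMk_right t) fun x => ⟨ht, mem_univ x⟩
  have hbd : ∀ τ ∈ Ioo 0 (b - a), ∀ x, ‖u (max a (min (τ + a) b)) x‖ ≤ C / Real.sqrt (-b) := by
    intro τ hτ x
    rw [hκid τ ⟨hτ.1.le, hτ.2.le⟩]
    have hτa : τ + a < 0 := by linarith [hτ.2]
    exact (hI (τ + a) hτa x).trans (div_sqrt_neg_le hC (neg_pos.2 hb) (by linarith [hτ.2]))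
  refine IsKNSSDriftMild.mk measurable_const (fun t => by simpa using hN0) hcont.measurable hbd
    ?_ ?_
  · exact Eventually.of_forall fun τ => hdiv _ (hκneg τ)
  · intro s t hs hst htT x
    have hsid : max a (min (s + a) b) = s + a := hκid s ⟨hs.le, (hst.trans htT).le⟩
    have htid : max a (min (t + a) b) = t + a := hκid t ⟨(hs.trans hst).le, htT.le⟩
    have hVm : ∀ σ ∈ Ioo s t, Measurable fun x => u (max a (min (σ + a) b)) x := fun σ _ =>
      (hslice _ (hκneg σ)).measurable
    have hVN : ∀ σ ∈ Ioo s t, ∀ y, ‖u (max a (min (σ + a) b)) y‖ ≤ C / Real.sqrt (-b) :=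
      fun σ hσ y => hbd σ ⟨hs.trans hσ.1, hσ.2.trans htT⟩ y
    rw [driftDuhamel_zero_eq_oseenDuhamel finrank_euclideanSpace_fin hVm hVN hst.le x]
    have hcongr : ∀ τ ∈ Ioo s t, (fun x => u (max a (min (τ + a) b)) x) = (fun σ => u (σ + a)) τ :=
      fun τ hτ => by
        funext y
        rw [hκid τ ⟨(hs.trans hτ.1).le, (hτ.2.trans htT).le⟩]
    rw [oseenDuhamel_congr_Ioo hcongr hcongr x, oseenDuhamel_translate]
    simp only [hsid, htid]
    have h := hmild (s + a) (t + a) (by linarith) (by linarith) x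
    rwa [show t + a - (s + a) = t - s by ring] at h

/-- **Joint smoothness on a window** of a continuous Type-I Oseen-mild ancient field
(KNSS 2009, Prop. 4.1 via `KNSS2009_prop41_mild_holds`, transported back along the shift
`t ↦ t - a`). [cite: KochNadirashviliSereginSverak2009, Prop. 4.1 (arXiv:0709.3599v1 p. 8)] -/
theorem isSmoothSpaceTimeOn_window (hc : ContinuousOn (uncurry u) (Iio 0 ×ˢ univ))
    (hdiv : ∀ t < 0, IsWeaklyDivFree (u t))
    (hmild : ∀ s t : ℝ, s < t → t < 0 → ∀ x,
      u t x = UnboundedOperators.heatExtension (u s) (t - s) x - oseenDuhamel 1 s u u t x)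
    (hI : HasTypeITimeDecay C u) {a b : ℝ} (hab : a < b) (hb : b < 0) :
    IsSmoothSpaceTimeOn (Ioo a b) u := by
  obtain ⟨-, -, hκid⟩ := clampShift_facts hab.le
  have hK := isKNSSDriftMild_window hc hdiv hmild hI hab hb
  obtain ⟨ε, -, Cst, -, hP⟩ := KNSS2009_prop41_mild_holds 0
  obtain ⟨hsm, -⟩ := hP hK
  -- transport along `(t, x) ↦ (t - a, x)`
  have hmap : ContDiff ℝ ((⊤ : ℕ∞) : WithTop ℕ∞)
      fun p : ℝ × EuclideanSpace ℝ (Fin 3) => (p.1 - a, p.2) :=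
    (contDiff_fst.sub contDiff_const).prodMk contDiff_snd
  have hinto : MapsTo (fun p : ℝ × EuclideanSpace ℝ (Fin 3) => (p.1 - a, p.2)) (Ioo a b ×ˢ univ)
      (Ioo 0 (b - a) ×ˢ univ) := by
    rintro ⟨t, x⟩ ⟨ht, -⟩
    exact ⟨⟨by linarith [ht.1], by linarith [ht.2]⟩, mem_univ _⟩
  have hcomp := hsm.comp hmap.contDiffOn hinto
  refine hcomp.congr ?_
  rintro ⟨t, x⟩ ⟨ht, -⟩
  simp only [comp_apply, uncurry_apply_pair]
  rw [hκid (t - a) ⟨by linarith [ht.1], by linarith [ht.2]⟩, sub_add_cancel]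

/-- **Joint smoothness on the whole open slab** `(-∞, 0) × ℝ³` of a continuous Type-I Oseen-mild
ancient field (smoothness is local; every `t < 0` lies in a window `(t - 1, t/2)`).
[cite: KochNadirashviliSereginSverak2009, Prop. 4.1 (arXiv:0709.3599v1 p. 8)] -/
theorem contDiffOn_slab (hc : ContinuousOn (uncurry u) (Iio 0 ×ˢ univ))
    (hdiv : ∀ t < 0, IsWeaklyDivFree (u t))
    (hmild : ∀ s t : ℝ, s < t → t < 0 → ∀ x,
      u t x = UnboundedOperators.heatExtension (u s) (t - s) x - oseenDuhamel 1 s u u t x)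
    (hI : HasTypeITimeDecay C u) :
    ContDiffOn ℝ (⊤ : ℕ∞) (uncurry u) (Iio 0 ×ˢ univ) := by
  refine contDiffOn_of_locally_contDiffOn ?_
  rintro ⟨t, x⟩ ⟨ht, -⟩
  have ht' : t < 0 := ht
  refine ⟨Ioo (t - 1) (t / 2) ×ˢ univ, isOpen_Ioo.prod isOpen_univ,
    ⟨⟨by linarith, by linarith⟩, mem_univ _⟩, ?_⟩
  have h := isSmoothSpaceTimeOn_window hc hdiv hmild hI (a := t - 1) (b := t / 2)
    (by linarith) (by linarith)
  exact ContDiffOn.mono h inter_subset_right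

/-- **A continuous Type-I Oseen-mild ancient field is a Type-I ancient mild solution in the
Oseen gauge** (`IsTypeIAncientMild C u`): joint smoothness by KNSS Prop. 4.1, pointwise
divergence-freeness from weak divergence-freeness of the smooth slices
(`isDivFree_of_ae_isWeaklyDivFree_of_smooth`), the integral equation with `heatFlow = e^{(t-s)Δ}`
for `t - s > 0`. [cite: KochNadirashviliSereginSverak2009, Prop. 4.1 and §6 p. 11 (arXiv:0709.3599v1)] -/
theorem isTypeIAncientMild_of_continuous_oseenMild (hc : ContinuousOn (uncurry u) (Iio 0 ×ˢ univ))
    (hdiv : ∀ t < 0, IsWeaklyDivFree (u t))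
    (hmild : ∀ s t : ℝ, s < t → t < 0 → ∀ x,
      u t x = UnboundedOperators.heatExtension (u s) (t - s) x - oseenDuhamel 1 s u u t x)
    (hI : HasTypeITimeDecay C u) : IsTypeIAncientMild C u := by
  refine ⟨contDiffOn_slab hc hdiv hmild hI, fun t ht => ?_, fun s t hst ht x => ?_, hI⟩
  · have hsm := isSmoothSpaceTimeOn_window hc hdiv hmild hI (a := t - 1) (b := t / 2)
      (by linarith) (by linarith)
    exact isDivFree_of_ae_isWeaklyDivFree_of_smooth hsm
      ((ae_restrict_mem measurableSet_Ioo).mono fun τ hτ => hdiv τ (hτ.2.trans (by linarith)))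
      ⟨by linarith, by linarith⟩
  · rw [heatFlow_of_pos _ (sub_pos.2 hst)]
    exact hmild s t hst ht x

/-! ### Uniform bounds over the class -/

end Window

end Literature.Analysis.NavierStokesZoomKit

end Part3

/-!
## Part 4 — port of `Summits/NavierStokesRegularity/NavierStokesRegularity/Theorems/SqueezeCycleSingularZoomWindow.lean` (6 declarations kept)

# Uniform regularity of continuous Type-I Oseen-mild fields on a final time window
# (route `SqueezeCycle`, item `SingularZoom`, stmt-NavierStokesRegularity-10573)

Helper file for the singular Type-I zoom (`SingularZoom`): the window-local twin of
`SqueezeCycleExtremalElementExistsRegularity`. There the fields live on the whole past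
`(-∞, 0) × ℝ³`; the zooms `u_k(s, y) = λ_k u(T + λ_k² s, x₀ + λ_k y)` of a Type-I classical
solution live only on `(A_k, 0) × ℝ³` with `A_k → -∞`. A field `u : ℝ → ℝ³ → ℝ³` which is
jointly continuous on `(A, 0) × ℝ³`, has weakly divergence-free slices there, satisfies the Oseen
integral equation `u t x = e^{(t-s)Δ}u(s)(x) - B¹_s(u,u)(t)(x)` for all `A < s < t < 0`, and obeys
the Type-I bound `‖u(t,x)‖ ≤ C/√(-t)` for `A < t < 0`, is — after a time shift and a clamp — a
restarted bounded mild field of KNSS 2009, §4 on every window `(a, b)`, `A < a < b < 0`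
(`isKNSSDriftMild_window_of_Ioo`). Consequently (KNSS 2009, Prop. 4.1 in the tree's rendering
`KNSS2009_prop41_mild_holds`, `KNSSBootstrap.exists_norm_iteratedFDeriv_slice_le`,
`KNSSBootstrap.exists_lipschitz_time_iteratedFDeriv`) it is jointly `C^∞` on `(A, 0) × ℝ³`
(`contDiffOn_of_Ioo`), and for every order `k`, window `a < b < 0` and margin `δ > 0` there are
constants depending on `k, a, b, δ, C` only which bound `‖Dᵏu(t)(x)‖` on `[a + δ, b) × ℝ³` and
the time-Lipschitz modulus of `Dᵏu(·)(x)` there, uniformly over all such fields with `A < a`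
(`exists_norm_iteratedFDeriv_le_of_typeI_Ioo`, `exists_lipschitz_time_of_typeI_Ioo`).
-/

section Part4

open _root_.MeasureTheory _root_.Set _root_.Function _root_.Filter _root_.TopologicalSpace _root_.Metric
open scoped _root_.Topology _root_.NNReal _root_.ENNReal

namespace Literature.Analysis.NavierStokesZoomKit

open Literature.Analysis Literature.Analysis.FluidPDE

section Window

variable {C A : ℝ} {u : ℝ → EuclideanSpace ℝ (Fin 3) → EuclideanSpace ℝ (Fin 3)}

/-- The Type-I constant of a field obeying `‖u(t,x)‖ ≤ C/√(-t)` at some time `t < 0` is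
nonnegative. [folklore]
[cite: KochNadirashviliSereginSverak2009, §§2–3 (source of the Type-I rescaling / ancient mild limit argument this module implements; this declaration is the cell’s own lemma, NOT a printed statement)] -/
theorem typeI_const_nonneg_of_norm_le {t : ℝ} (ht : t < 0) (x : EuclideanSpace ℝ (Fin 3))
    (h : ‖u t x‖ ≤ C / Real.sqrt (-t)) : 0 ≤ C := by
  have hs : 0 < Real.sqrt (-t) := Real.sqrt_pos.2 (neg_pos.2 ht)
  by_contra hC
  have : C / Real.sqrt (-t) < 0 := div_neg_of_neg_of_pos (not_le.1 hC) hs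
  linarith [norm_nonneg (u t x)]

/-- **A continuous Type-I Oseen-mild field on `(A, 0)` is a restarted bounded mild field on
every window `(a, b)`, `A < a < b < 0`** (KNSS 2009, §4 (i)): the clamped shift
`V τ x = u (max a (min (τ + a) b)) x` satisfies `IsKNSSDriftMild (b - a) (C/√(-b)) V 0`
(the window-local twin of `isKNSSDriftMild_window`: only the values of `u` at times of
`[a, b] ⊆ (A, 0)` enter). [cite: KochNadirashviliSereginSverak2009, §4 (i) (arXiv:0709.3599v1 p. 8)] -/
theorem isKNSSDriftMild_window_of_Ioo (hc : ContinuousOn (uncurry u) (Ioo A 0 ×ˢ univ))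
    (hdiv : ∀ t ∈ Ioo A 0, IsWeaklyDivFree (u t))
    (hmild : ∀ s t : ℝ, A < s → s < t → t < 0 → ∀ x,
      u t x = UnboundedOperators.heatExtension (u s) (t - s) x - oseenDuhamel 1 s u u t x)
    (hI : ∀ t ∈ Ioo A 0, ∀ x, ‖u t x‖ ≤ C / Real.sqrt (-t)) {a b : ℝ} (hAa : A < a)
    (hab : a < b) (hb : b < 0) :
    IsKNSSDriftMild (b - a) (C / Real.sqrt (-b)) (fun τ x => u (max a (min (τ + a) b)) x) 0 := by
  obtain ⟨hκc, hκmem, hκid⟩ := clampShift_facts hab.le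
  have hbI : b ∈ Ioo A 0 := ⟨hAa.trans hab, hb⟩
  have hC : 0 ≤ C := typeI_const_nonneg_of_norm_le hb 0 (hI b hbI 0)
  have hN0 : 0 ≤ C / Real.sqrt (-b) := by positivity
  have hκneg : ∀ τ, max a (min (τ + a) b) < 0 := fun τ => (hκmem τ).2.trans_lt hb
  have hκA : ∀ τ, A < max a (min (τ + a) b) := fun τ => hAa.trans_le (hκmem τ).1
  have hκI : ∀ τ, max a (min (τ + a) b) ∈ Ioo A 0 := fun τ => ⟨hκA τ, hκneg τ⟩
  have hcont : Continuous (uncurry fun τ x => u (max a (min (τ + a) b)) x) := by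
    have hmap : Continuous fun p : ℝ × EuclideanSpace ℝ (Fin 3) =>
        (max a (min (p.1 + a) b), p.2) :=
      (hκc.comp continuous_fst).prodMk continuous_snd
    have hinto : ∀ p : ℝ × EuclideanSpace ℝ (Fin 3),
        (max a (min (p.1 + a) b), p.2) ∈ Ioo A (0 : ℝ) ×ˢ (univ : Set (EuclideanSpace ℝ (Fin 3))) :=
      fun p => ⟨hκI p.1, mem_univ _⟩
    exact (hc.comp_continuous hmap hinto).congr fun p => rfl
  have hslice : ∀ t ∈ Ioo A 0, Continuous (u t) := fun t ht =>
    hc.comp_continuous (Continuous.prodMk_right t) fun x => ⟨ht, mem_univ x⟩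
  have hbd : ∀ τ ∈ Ioo 0 (b - a), ∀ x, ‖u (max a (min (τ + a) b)) x‖ ≤ C / Real.sqrt (-b) := by
    intro τ hτ x
    rw [hκid τ ⟨hτ.1.le, hτ.2.le⟩]
    have hτa : τ + a < 0 := by linarith [hτ.2]
    have hτA : A < τ + a := by linarith [hτ.1]
    exact (hI (τ + a) ⟨hτA, hτa⟩ x).trans (div_sqrt_neg_le hC (neg_pos.2 hb) (by linarith [hτ.2]))
  refine IsKNSSDriftMild.mk measurable_const (fun t => by simpa using hN0) hcont.measurable hbd
    ?_ ?_
  · exact Eventually.of_forall fun τ => hdiv _ (hκI τ)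
  · intro s t hs hst htT x
    have hsid : max a (min (s + a) b) = s + a := hκid s ⟨hs.le, (hst.trans htT).le⟩
    have htid : max a (min (t + a) b) = t + a := hκid t ⟨(hs.trans hst).le, htT.le⟩
    have hVm : ∀ σ ∈ Ioo s t, Measurable fun x => u (max a (min (σ + a) b)) x := fun σ _ =>
      (hslice _ (hκI σ)).measurable
    have hVN : ∀ σ ∈ Ioo s t, ∀ y, ‖u (max a (min (σ + a) b)) y‖ ≤ C / Real.sqrt (-b) :=
      fun σ hσ y => hbd σ ⟨hs.trans hσ.1, hσ.2.trans htT⟩ y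
    rw [driftDuhamel_zero_eq_oseenDuhamel finrank_euclideanSpace_fin hVm hVN hst.le x]
    have hcongr : ∀ τ ∈ Ioo s t, (fun x => u (max a (min (τ + a) b)) x) = (fun σ => u (σ + a)) τ :=
      fun τ hτ => by
        funext y
        rw [hκid τ ⟨(hs.trans hτ.1).le, (hτ.2.trans htT).le⟩]
    rw [oseenDuhamel_congr_Ioo hcongr hcongr x, oseenDuhamel_translate]
    simp only [hsid, htid]
    have h := hmild (s + a) (t + a) (by linarith) (by linarith) (by linarith) x
    rwa [show t + a - (s + a) = t - s by ring] at h

/-- **Joint smoothness on a window** `(a, b)`, `A < a < b < 0`, of a continuous Type-I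
Oseen-mild field on `(A, 0)` (KNSS 2009, Prop. 4.1 via `KNSS2009_prop41_mild_holds`, transported
back along the shift `t ↦ t - a`). [cite: KochNadirashviliSereginSverak2009, Prop. 4.1 (arXiv:0709.3599v1 p. 8)] -/
theorem isSmoothSpaceTimeOn_window_of_Ioo (hc : ContinuousOn (uncurry u) (Ioo A 0 ×ˢ univ))
    (hdiv : ∀ t ∈ Ioo A 0, IsWeaklyDivFree (u t))
    (hmild : ∀ s t : ℝ, A < s → s < t → t < 0 → ∀ x,
      u t x = UnboundedOperators.heatExtension (u s) (t - s) x - oseenDuhamel 1 s u u t x)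
    (hI : ∀ t ∈ Ioo A 0, ∀ x, ‖u t x‖ ≤ C / Real.sqrt (-t)) {a b : ℝ} (hAa : A < a)
    (hab : a < b) (hb : b < 0) :
    IsSmoothSpaceTimeOn (Ioo a b) u := by
  obtain ⟨-, -, hκid⟩ := clampShift_facts hab.le
  have hK := isKNSSDriftMild_window_of_Ioo hc hdiv hmild hI hAa hab hb
  obtain ⟨ε, -, Cst, -, hP⟩ := KNSS2009_prop41_mild_holds 0
  obtain ⟨hsm, -⟩ := hP hK
  have hmap : ContDiff ℝ ((⊤ : ℕ∞) : WithTop ℕ∞)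
      fun p : ℝ × EuclideanSpace ℝ (Fin 3) => (p.1 - a, p.2) :=
    (contDiff_fst.sub contDiff_const).prodMk contDiff_snd
  have hinto : MapsTo (fun p : ℝ × EuclideanSpace ℝ (Fin 3) => (p.1 - a, p.2)) (Ioo a b ×ˢ univ)
      (Ioo 0 (b - a) ×ˢ univ) := by
    rintro ⟨t, x⟩ ⟨ht, -⟩
    exact ⟨⟨by linarith [ht.1], by linarith [ht.2]⟩, mem_univ _⟩
  have hcomp := hsm.comp hmap.contDiffOn hinto
  refine hcomp.congr ?_
  rintro ⟨t, x⟩ ⟨ht, -⟩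
  simp only [comp_apply, uncurry_apply_pair]
  rw [hκid (t - a) ⟨by linarith [ht.1], by linarith [ht.2]⟩, sub_add_cancel]

/-- **Joint smoothness on the whole domain** `(A, 0) × ℝ³` of a continuous Type-I Oseen-mild
field on `(A, 0)` (smoothness is local; every `A < t < 0` lies in a window `(a, t/2)` with
`A < a < t`). [cite: KochNadirashviliSereginSverak2009, Prop. 4.1 (arXiv:0709.3599v1 p. 8)] -/
theorem contDiffOn_of_Ioo (hc : ContinuousOn (uncurry u) (Ioo A 0 ×ˢ univ))
    (hdiv : ∀ t ∈ Ioo A 0, IsWeaklyDivFree (u t))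
    (hmild : ∀ s t : ℝ, A < s → s < t → t < 0 → ∀ x,
      u t x = UnboundedOperators.heatExtension (u s) (t - s) x - oseenDuhamel 1 s u u t x)
    (hI : ∀ t ∈ Ioo A 0, ∀ x, ‖u t x‖ ≤ C / Real.sqrt (-t)) :
    ContDiffOn ℝ (⊤ : ℕ∞) (uncurry u) (Ioo A 0 ×ˢ univ) := by
  refine contDiffOn_of_locally_contDiffOn ?_
  rintro ⟨t, x⟩ ⟨ht, -⟩
  have htA : A < t := ht.1
  have ht0 : t < 0 := ht.2
  refine ⟨Ioo ((A + t) / 2) (t / 2) ×ˢ univ, isOpen_Ioo.prod isOpen_univ,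
    ⟨⟨by linarith, by linarith⟩, mem_univ _⟩, ?_⟩
  have h := isSmoothSpaceTimeOn_window_of_Ioo hc hdiv hmild hI (a := (A + t) / 2) (b := t / 2)
    (by linarith) (by linarith) (by linarith)
  exact ContDiffOn.mono h inter_subset_right

/-! ### Uniform bounds over all fields with the same Type-I constant -/

/-- **Uniform bounds for all `x`-derivatives on a window** (KNSS 2009, (4.10) via
`KNSSBootstrap.exists_norm_iteratedFDeriv_slice_le`): for `k`, a window `a < b < 0` and a margin
`δ > 0` there is `K = K(k, a, b, δ, C)` with `‖Dᵏu(t)(x)‖ ≤ K` for all `t ∈ [a + δ, b)`, all `x`,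
and **all** continuous Type-I Oseen-mild fields `u` on `(A, 0)`, `A < a`, with Type-I constant
`C`. [cite: KochNadirashviliSereginSverak2009, §4 (4.10) with Prop. 4.1 (4.6) (arXiv:0709.3599v1 p. 8)] -/
theorem exists_norm_iteratedFDeriv_le_of_typeI_Ioo (C : ℝ) (k : ℕ) {a b δ : ℝ} (hab : a < b)
    (hb : b < 0) (hδ : 0 < δ) :
    ∃ K : ℝ, ∀ ⦃A : ℝ⦄ ⦃u : ℝ → EuclideanSpace ℝ (Fin 3) → EuclideanSpace ℝ (Fin 3)⦄, A < a →
      ContinuousOn (uncurry u) (Ioo A 0 ×ˢ univ) →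
      (∀ t ∈ Ioo A 0, IsWeaklyDivFree (u t)) →
      (∀ s t : ℝ, A < s → s < t → t < 0 → ∀ x,
        u t x = UnboundedOperators.heatExtension (u s) (t - s) x - oseenDuhamel 1 s u u t x) →
      (∀ t ∈ Ioo A 0, ∀ x, ‖u t x‖ ≤ C / Real.sqrt (-t)) →
      ∀ t ∈ Ico (a + δ) b, ∀ x, ‖iteratedFDeriv ℝ k (u t) x‖ ≤ K := by
  obtain ⟨Cf, hCf⟩ := KNSSBootstrap.exists_norm_iteratedFDeriv_slice_le
    (E := EuclideanSpace ℝ (Fin 3))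
    finrank_euclideanSpace_fin (T := b - a) (N := C / Real.sqrt (-b)) k
  refine ⟨Cf δ, fun A u hAa hc hdiv hmild hI t ht x => ?_⟩
  obtain ⟨-, -, hκid⟩ := clampShift_facts hab.le
  have hK := isKNSSDriftMild_window_of_Ioo hc hdiv hmild hI hAa hab hb
  have h : ‖iteratedFDeriv ℝ k (fun y => u (max a (min (t - a + a) b)) y) x‖ ≤ Cf δ :=
    hCf hK δ hδ (t - a) ⟨by linarith [ht.1], by linarith [ht.2]⟩ x
  have hV : (fun y => u (max a (min (t - a + a) b)) y) = u t := by
    funext y; rw [hκid (t - a) ⟨by linarith [ht.1], by linarith [ht.2]⟩, sub_add_cancel]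
  rwa [hV] at h

/-- **Uniform time-Lipschitz bounds for all `x`-derivatives on a window** (KNSS 2009, (4.11)
via `KNSSBootstrap.exists_lipschitz_time_iteratedFDeriv`): for `k`, `a < b < 0`, `δ > 0` there
is `L = L(k, a, b, δ, C) ≥ 0` with `‖Dᵏu(t)(x) − Dᵏu(s)(x)‖ ≤ L |t − s|` for all
`s, t ∈ [a + δ, b)`, all `x`, and all continuous Type-I Oseen-mild fields `u` on `(A, 0)`,
`A < a`, with Type-I constant `C`. [cite: KochNadirashviliSereginSverak2009, §4 (4.11) (arXiv:0709.3599v1 p. 8)] -/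
theorem exists_lipschitz_time_of_typeI_Ioo (C : ℝ) (k : ℕ) {a b δ : ℝ} (hab : a < b) (hb : b < 0)
    (hδ : 0 < δ) :
    ∃ L : ℝ, 0 ≤ L ∧ ∀ ⦃A : ℝ⦄ ⦃u : ℝ → EuclideanSpace ℝ (Fin 3) → EuclideanSpace ℝ (Fin 3)⦄, A < a →
      ContinuousOn (uncurry u) (Ioo A 0 ×ˢ univ) →
      (∀ t ∈ Ioo A 0, IsWeaklyDivFree (u t)) →
      (∀ s t : ℝ, A < s → s < t → t < 0 → ∀ x,
        u t x = UnboundedOperators.heatExtension (u s) (t - s) x - oseenDuhamel 1 s u u t x) →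
      (∀ t ∈ Ioo A 0, ∀ x, ‖u t x‖ ≤ C / Real.sqrt (-t)) →
      ∀ s ∈ Ico (a + δ) b, ∀ t ∈ Ico (a + δ) b, ∀ x,
        ‖iteratedFDeriv ℝ k (u t) x - iteratedFDeriv ℝ k (u s) x‖ ≤ L * |t - s| := by
  obtain ⟨L, hL0, hL⟩ := KNSSBootstrap.exists_lipschitz_time_iteratedFDeriv
    (E := EuclideanSpace ℝ (Fin 3))
    finrank_euclideanSpace_fin (T := b - a) (N := C / Real.sqrt (-b)) k hδ
  refine ⟨L, hL0, fun A u hAa hc hdiv hmild hI s hs t ht x => ?_⟩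
  obtain ⟨-, -, hκid⟩ := clampShift_facts hab.le
  have hK := isKNSSDriftMild_window_of_Ioo hc hdiv hmild hI hAa hab hb
  have h : ‖iteratedFDeriv ℝ k (fun y => u (max a (min (t - a + a) b)) y) x -
      iteratedFDeriv ℝ k (fun y => u (max a (min (s - a + a) b)) y) x‖ ≤ L * |t - a - (s - a)| :=
    hL hK (s - a) ⟨by linarith [hs.1], by linarith [hs.2]⟩ (t - a)
      ⟨by linarith [ht.1], by linarith [ht.2]⟩ x
  have hVt : (fun y => u (max a (min (t - a + a) b)) y) = u t := by
    funext y; rw [hκid (t - a) ⟨by linarith [ht.1], by linarith [ht.2]⟩, sub_add_cancel]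
  have hVs : (fun y => u (max a (min (s - a + a) b)) y) = u s := by
    funext y; rw [hκid (s - a) ⟨by linarith [hs.1], by linarith [hs.2]⟩, sub_add_cancel]
  rwa [hVt, hVs, show t - a - (s - a) = t - s by ring] at h

end Window

end Literature.Analysis.NavierStokesZoomKit

end Part4

/-!
## Part 5 — port of `Summits/NavierStokesRegularity/NavierStokesRegularity/Theorems/SqueezeCycleExtremalElementExistsExtraction.lean` (1 declarations kept)

# `C¹_loc` compactness of the Type-I ancient mild class (route `SqueezeCycle`,
# item `ExtremalElementExists`, stmt-NavierStokesRegularity-11611)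

Helper file. A sequence `w k` of Type-I ancient mild fields in the Oseen gauge with a common
Type-I constant `C` (`IsTypeIAncientMild C (w k)`) has a subsequence converging, together with
its spatial gradients, locally uniformly on the open slab `(-∞, 0) × ℝ³` to a field `W` of the
same class (`exists_tendsto_of_isTypeIAncientMild_seq`):

1. on the compact pieces `[−(n+2), −1/(n+2)] × B̄(0, n+2)` the pairs `(w k, ∇w k)` are bounded and
   uniformly Lipschitz (the class-uniform bounds on `w, ∇w, ∇²w` and the time-Lipschitz moduli
   of `w, ∇w`, `SqueezeCycleExtremalElementExistsRegularity`);
2. the diagonal Arzelà–Ascoli extraction `exists_strictMono_tendstoUniformlyOn_of_bound`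
   applied to the pair maps gives `φ` and a limit pair `(W, G)`; uniform limits of gradients are
   gradients (`hasFDerivAt_of_tendstoLocallyUniformlyOn`), so `G = ∇W`;
3. the Type-I bound, weak divergence-freeness and the Oseen integral equation pass to the limit
   (dominated convergence, `OseenDuhamelLimits`), and `W` is again in the class by
   `isTypeIAncientMild_of_continuous_oseenMild` (KNSS 2009, Prop. 4.1).

Not carried from this source module (not needed by the declarations re-homed here; their consumers are Summits-side): `exists_tendsto_of_isTypeIAncientMild_seq`.
-/

section Part5

open _root_.MeasureTheory _root_.Set _root_.Function _root_.Filter _root_.TopologicalSpace _root_.Metric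
open scoped _root_.Topology _root_.NNReal _root_.ENNReal _root_.InnerProductSpace RealInnerProductSpace

namespace Literature.Analysis.NavierStokesZoomKit

open Literature.Analysis Literature.Analysis.FluidPDE

section Norms

variable {E F : Type*} [NormedAddCommGroup E] [NormedSpace ℝ E] [NormedAddCommGroup F]
  [NormedSpace ℝ F]

/-- `‖D¹f(x) − D¹g(x)‖ = ‖Df(x) − Dg(x)‖`. [folklore]
[cite: KochNadirashviliSereginSverak2009, §§2–3 (source of the Type-I rescaling / ancient mild limit argument this module implements; this declaration is the cell’s own lemma, NOT a printed statement)] -/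
theorem norm_iteratedFDeriv_one_sub (f g : E → F) (x : E) :
    ‖iteratedFDeriv ℝ 1 f x - iteratedFDeriv ℝ 1 g x‖ = ‖fderiv ℝ f x - fderiv ℝ g x‖ := by
  rw [FunctionSpaces.iteratedFDeriv_one_eq_symm_comp_fderiv f,
    FunctionSpaces.iteratedFDeriv_one_eq_symm_comp_fderiv g, ← map_sub,
    LinearIsometryEquiv.norm_map]

end Norms

section Compactness

end Compactness

end Literature.Analysis.NavierStokesZoomKit

end Part5

/-!
## Part 6 — port of `Summits/NavierStokesRegularity/NavierStokesRegularity/Theorems/SqueezeCycleSingularZoomExtraction.lean` (2 declarations kept)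

# `C¹_loc` compactness of Type-I Oseen-mild fields on growing final windows
# (route `SqueezeCycle`, item `SingularZoom`, stmt-NavierStokesRegularity-10573)

Helper file for the singular Type-I zoom. A sequence `w k` of fields which are jointly continuous
on `(A k, 0) × ℝ³`, have weakly divergence-free slices there, satisfy the Oseen integral equation
between all `A k < s < t < 0` and obey a common Type-I bound `‖w k t x‖ ≤ C/√(-t)` on `(A k, 0)`,
where `A k → -∞`, has a subsequence converging together with its spatial gradients at every
point of the open slab `(-∞, 0) × ℝ³` — slice-wise even locally uniformly — to a Type-I ancient
mild field `W` of the Oseen gauge with the same constant (`IsTypeIAncientMild C W`)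
(`exists_tendsto_of_typeI_seq_Ioo`). This is the tree's
`exists_tendsto_of_isTypeIAncientMild_seq` (ancient fields) with the window-local uniform bounds
of `SqueezeCycleSingularZoomWindow` (KNSS 2009, Prop. 4.1, (4.10)–(4.11)) in place of the
class-uniform ones: on each compact slab piece the pairs `(w k, ∇w k)` are bounded and uniformly
Lipschitz for all large `k`, a diagonal Arzelà–Ascoli extraction gives the limit pair, uniform
limits of gradients are gradients, and the Type-I bound, weak divergence-freeness and the Oseen
equation pass to the limit by dominated convergence (KNSS 2009, Lemma 6.1).
-/

section Part6

open _root_.MeasureTheory _root_.Set _root_.Function _root_.Filter _root_.TopologicalSpace _root_.Metric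
open scoped _root_.Topology _root_.NNReal _root_.ENNReal _root_.InnerProductSpace RealInnerProductSpace

namespace Literature.Analysis.NavierStokesZoomKit

open Literature.Analysis Literature.Analysis.FluidPDE

section Shift

variable {X Y : Type*} [UniformSpace Y]

/-- Uniform convergence along `atTop` is preserved by an index shift `j ↦ j + j₀`. [folklore]
[cite: KochNadirashviliSereginSverak2009, §§2–3 (source of the Type-I rescaling / ancient mild limit argument this module implements; this declaration is the cell’s own lemma, NOT a printed statement)] -/
theorem tendstoUniformlyOn_shift {F : ℕ → X → Y} {f : X → Y} {s : Set X}
    (h : TendstoUniformlyOn F f atTop s) (j₀ : ℕ) :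
    TendstoUniformlyOn (fun j => F (j + j₀)) f atTop s :=
  fun u hu => (tendsto_add_atTop_nat j₀).eventually (h u hu)

end Shift

section Compactness

/-- **`C¹_loc` compactness of Type-I Oseen-mild fields on growing final windows.** Let `w k` be
jointly continuous on `(A k, 0) × ℝ³` with weakly divergence-free slices, satisfy the Oseen
integral equation `w k t = e^{(t−s)Δ} w k s − B¹_s(w k, w k)(t)` for all `A k < s < t < 0`, and
obey `‖w k t x‖ ≤ C/√(−t)` for `A k < t < 0`, where `A k → −∞`. Then along some subsequence `φ`
the fields and their spatial gradients converge at every point of the open slab `(-∞, 0) × ℝ³` —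
the slices even locally uniformly — to a Type-I ancient mild field `W` of the Oseen gauge with
constant `C` and to its gradient. [cite: KochNadirashviliSereginSverak2009, Lemma 6.1 and Prop. 4.1 (arXiv:0709.3599 pp. 8, 11)] -/
theorem exists_tendsto_of_typeI_seq_Ioo (C : ℝ) {A : ℕ → ℝ} (hA : Tendsto A atTop atBot)
    {w : ℕ → ℝ → EuclideanSpace ℝ (Fin 3) → EuclideanSpace ℝ (Fin 3)}
    (hc : ∀ k, ContinuousOn (uncurry (w k)) (Ioo (A k) 0 ×ˢ univ))
    (hdivw : ∀ k, ∀ t ∈ Ioo (A k) 0, IsWeaklyDivFree (w k t))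
    (hmild : ∀ k, ∀ s t : ℝ, A k < s → s < t → t < 0 → ∀ x,
      w k t x = UnboundedOperators.heatExtension (w k s) (t - s) x - oseenDuhamel 1 s (w k) (w k) t x)
    (hI : ∀ k, ∀ t ∈ Ioo (A k) 0, ∀ x, ‖w k t x‖ ≤ C / Real.sqrt (-t)) :
    ∃ φ : ℕ → ℕ, StrictMono φ ∧
      ∃ W : ℝ → EuclideanSpace ℝ (Fin 3) → EuclideanSpace ℝ (Fin 3), IsTypeIAncientMild C W ∧
        (∀ t < 0, ∀ x, Tendsto (fun j => w (φ j) t x) atTop (𝓝 (W t x))) ∧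
        (∀ t < 0, ∀ x, Tendsto (fun j => fderiv ℝ (w (φ j) t) x) atTop (𝓝 (fderiv ℝ (W t) x))) ∧
        (∀ t < 0, TendstoLocallyUniformly (fun j => w (φ j) t) (W t) atTop) ∧
        (∀ t < 0, TendstoLocallyUniformly (fun j => fderiv ℝ (w (φ j) t)) (fderiv ℝ (W t)) atTop) := by
  -- ## Step 0: per-`k` facts on `(A k, 0)`
  have hsm : ∀ k, ContDiffOn ℝ (⊤ : ℕ∞) (uncurry (w k)) (Ioo (A k) 0 ×ˢ univ) := fun k =>
    contDiffOn_of_Ioo (hc k) (hdivw k) (hmild k) (hI k)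
  have hDc : ∀ k, ContinuousOn (fun z : ℝ × EuclideanSpace ℝ (Fin 3) => fderiv ℝ (w k z.1) z.2)
      (Ioo (A k) 0 ×ˢ univ) := fun k =>
    IsSmoothSpaceTimeOn.continuousOn_fderiv_slice (S := Ioo (A k) 0) (w := w k) (hsm k)
      isOpen_Ioo.uniqueDiffOn
  have hsmooth : ∀ k, ∀ t ∈ Ioo (A k) 0, ContDiff ℝ ((⊤ : ℕ∞) : WithTop ℕ∞) (w k t) :=
    fun k t ht => (hsm k).comp_contDiff (contDiff_prodMk_right t) fun x => ⟨ht, mem_univ x⟩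
  have hdiff : ∀ k, ∀ t ∈ Ioo (A k) 0, Differentiable ℝ (w k t) := fun k t ht =>
    (hsmooth k t ht).differentiable (by simp)
  have hdiff2 : ∀ k, ∀ t ∈ Ioo (A k) 0, Differentiable ℝ (fderiv ℝ (w k t)) := fun k t ht =>
    ((hsmooth k t ht).fderiv_right (m := 1) (by norm_cast)).differentiable (by simp)
  have hslice : ∀ k, ∀ t ∈ Ioo (A k) 0, Continuous (w k t) := fun k t ht =>
    (hc k).comp_continuous (Continuous.prodMk_right t) fun x => ⟨ht, mem_univ x⟩
  -- `0 ≤ C` (some window is nonempty)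
  have hC : 0 ≤ C := by
    obtain ⟨k, hk⟩ := (hA.eventually (eventually_lt_atBot (-1 : ℝ))).exists
    exact typeI_const_nonneg_of_norm_le (u := w k) (by norm_num) 0
      (hI k (-1) ⟨hk, by norm_num⟩ 0)
  -- ## Step 1: windows and window-uniform constants on the pieces
  set a : ℕ → ℝ := fun n => -((n : ℝ) + 3) with ha
  set b : ℕ → ℝ := fun n => -(1 / (2 * ((n : ℝ) + 2))) with hb
  have hab : ∀ n, a n < b n := fun n => by
    have : (0 : ℝ) < 1 / (2 * ((n : ℝ) + 2)) := by positivity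
    have h2 : 1 / (2 * ((n : ℝ) + 2)) ≤ 1 := by
      rw [div_le_one (by positivity)]; linarith [(Nat.cast_nonneg n : (0 : ℝ) ≤ n)]
    simp only [ha, hb]; linarith [(Nat.cast_nonneg n : (0 : ℝ) ≤ n)]
  have hb0 : ∀ n, b n < 0 := fun n => by
    have : (0 : ℝ) < 1 / (2 * ((n : ℝ) + 2)) := by positivity
    simp only [hb]; linarith
  have hab1 : ∀ n, a n + 1 < b n := fun n => by
    have h2 : 1 / (2 * ((n : ℝ) + 2)) ≤ 1 := by
      rw [div_le_one (by positivity)]; linarith [(Nat.cast_nonneg n : (0 : ℝ) ≤ n)]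
    simp only [ha, hb]; linarith [(Nat.cast_nonneg n : (0 : ℝ) ≤ n)]
  -- eventually the window `(a n, b n)` lies inside `(A k, 0)`
  have hAa : ∀ n, ∀ᶠ k in atTop, A k < a n := fun n => hA.eventually (eventually_lt_atBot (a n))
  -- the slab pieces
  set T : ℕ → Set (ℝ × EuclideanSpace ℝ (Fin 3)) := fun n =>
    Icc (-((n : ℝ) + 2)) (-(1 / ((n : ℝ) + 2))) ×ˢ closedBall (0 : EuclideanSpace ℝ (Fin 3)) ((n : ℝ) + 2)
    with hT
  have hTwin : ∀ n, ∀ z ∈ T n, z.1 ∈ Ico (a n + 1) (b n) := fun n z hz => by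
    obtain ⟨⟨h1, h2⟩, -⟩ := mem_slabPiece.1 hz
    have hn2 : (0 : ℝ) < (n : ℝ) + 2 := by positivity
    refine ⟨by simp only [ha]; linarith, lt_of_le_of_lt h2 ?_⟩
    simp only [hb]
    rw [neg_lt_neg_iff, div_lt_div_iff_of_pos_left one_pos (by positivity) hn2]
    linarith
  have hTneg : ∀ n, ∀ z ∈ T n, z.1 < 0 := fun n z hz => ((hTwin n z hz).2).trans (hb0 n)
  have hTA : ∀ n k, A k < a n → ∀ z ∈ T n, z.1 ∈ Ioo (A k) 0 := fun n k hk z hz =>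
    ⟨by linarith [(hTwin n z hz).1], hTneg n z hz⟩
  -- constants
  have e0 := fun n : ℕ => exists_norm_iteratedFDeriv_le_of_typeI_Ioo C 0 (hab n) (hb0 n) one_pos
  have e1 := fun n : ℕ => exists_norm_iteratedFDeriv_le_of_typeI_Ioo C 1 (hab n) (hb0 n) one_pos
  have e2 := fun n : ℕ => exists_norm_iteratedFDeriv_le_of_typeI_Ioo C 2 (hab n) (hb0 n) one_pos
  have l0 := fun n : ℕ => exists_lipschitz_time_of_typeI_Ioo C 0 (hab n) (hb0 n) one_pos
  have l1 := fun n : ℕ => exists_lipschitz_time_of_typeI_Ioo C 1 (hab n) (hb0 n) one_pos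
  choose K0 hK0 using e0
  choose K1 hK1 using e1
  choose K2 hK2 using e2
  choose L0 hL00 hL0 using l0
  choose L1 hL10 hL1 using l1
  -- pointwise bounds on the pieces, for every `k` with `A k < a n`
  have hB0 : ∀ n k, A k < a n → ∀ z ∈ T n, ‖w k z.1 z.2‖ ≤ K0 n := fun n k hk z hz => by
    have h := hK0 n hk (hc k) (hdivw k) (hmild k) (hI k) z.1 (hTwin n z hz) z.2
    rwa [norm_iteratedFDeriv_zero] at h
  have hB1 : ∀ n k, A k < a n → ∀ t ∈ Ico (a n + 1) (b n), ∀ x, ‖fderiv ℝ (w k t) x‖ ≤ K1 n :=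
    fun n k hk t ht x => by
    have h := hK1 n hk (hc k) (hdivw k) (hmild k) (hI k) t ht x
    rwa [norm_iteratedFDeriv_one] at h
  have hB2 : ∀ n k, A k < a n → ∀ t ∈ Ico (a n + 1) (b n), ∀ x,
      ‖fderiv ℝ (fderiv ℝ (w k t)) x‖ ≤ K2 n := fun n k hk t ht x => by
    have h := hK2 n hk (hc k) (hdivw k) (hmild k) (hI k) t ht x
    rwa [← FunctionSpaces.norm_fderiv_fderiv_eq_norm_iteratedFDeriv_two] at h
  have hK1nn : ∀ n, 0 ≤ K1 n := fun n => by
    obtain ⟨k, hk⟩ := (hAa n).exists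
    exact (norm_nonneg _).trans (hB1 n k hk (a n + 1) ⟨le_rfl, hab1 n⟩ 0)
  have hK2nn : ∀ n, 0 ≤ K2 n := fun n => by
    obtain ⟨k, hk⟩ := (hAa n).exists
    exact (norm_nonneg (fderiv ℝ (fderiv ℝ (w k (a n + 1))) 0)).trans
      (hB2 n k hk (a n + 1) ⟨le_rfl, hab1 n⟩ 0)
  -- ## Step 2: the pair maps and their moduli on the pieces (for all large `k`)
  set V : ℕ → ℝ × EuclideanSpace ℝ (Fin 3) →
      EuclideanSpace ℝ (Fin 3) × (EuclideanSpace ℝ (Fin 3) →L[ℝ] EuclideanSpace ℝ (Fin 3)) :=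
    fun k z => (w k z.1 z.2, fderiv ℝ (w k z.1) z.2) with hV
  have hVn : ∀ n : ℕ, ∀ᶠ k in atTop, ContinuousOn (V k) (T n) ∧
      (∀ z ∈ T n, ‖V k z‖ ≤ max (K0 n) (K1 n)) ∧
      ∀ z ∈ T n, ∀ z' ∈ T n,
        dist (V k z) (V k z') ≤ (K1 n + L0 n + (K2 n + L1 n)) * dist z z' ^ (1 : ℝ) := by
    intro n
    filter_upwards [hAa n] with k hk
    refine ⟨?_, fun z hz => ?_, fun z hz z' hz' => ?_⟩
    · have hsub : T n ⊆ Ioo (A k) 0 ×ˢ univ := fun z hz => ⟨hTA n k hk z hz, mem_univ _⟩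
      exact ((hc k).mono hsub).prodMk ((hDc k).mono hsub)
    · rw [hV, Prod.norm_mk]
      exact max_le_max (hB0 n k hk z hz) (hB1 n k hk z.1 (hTwin n z hz) z.2)
    · rw [Real.rpow_one]
      have ht := hTwin n z hz
      have ht' := hTwin n z' hz'
      have hzA := hTA n k hk z hz
      have hdt : |z.1 - z'.1| ≤ dist z z' := by
        rw [← Real.dist_eq, Prod.dist_eq]; exact le_max_left _ _
      have hdx : ‖z.2 - z'.2‖ ≤ dist z z' := by
        rw [← dist_eq_norm, Prod.dist_eq]; exact le_max_right _ _
      have hd0 : 0 ≤ dist z z' := dist_nonneg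
      -- values
      have hv1 : ‖w k z.1 z.2 - w k z.1 z'.2‖ ≤ K1 n * ‖z.2 - z'.2‖ :=
        (convex_univ.norm_image_sub_le_of_norm_fderiv_le (fun x _ => (hdiff k z.1 hzA) x)
          (fun x _ => hB1 n k hk z.1 ht x) (mem_univ z'.2) (mem_univ z.2))
      have hv2 : ‖w k z.1 z'.2 - w k z'.1 z'.2‖ ≤ L0 n * |z.1 - z'.1| := by
        have h := hL0 n hk (hc k) (hdivw k) (hmild k) (hI k) z'.1 ht' z.1 ht z'.2
        rwa [DerivInterp.norm_iteratedFDeriv_zero_sub] at h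
      have hval : ‖w k z.1 z.2 - w k z'.1 z'.2‖ ≤ (K1 n + L0 n) * dist z z' := by
        calc ‖w k z.1 z.2 - w k z'.1 z'.2‖
            ≤ ‖w k z.1 z.2 - w k z.1 z'.2‖ + ‖w k z.1 z'.2 - w k z'.1 z'.2‖ :=
              norm_sub_le_norm_sub_add_norm_sub _ _ _
          _ ≤ K1 n * dist z z' + L0 n * dist z z' := add_le_add
              (hv1.trans (mul_le_mul_of_nonneg_left hdx (hK1nn n)))
              (hv2.trans (mul_le_mul_of_nonneg_left hdt (hL00 n)))
          _ = (K1 n + L0 n) * dist z z' := by ring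
      -- gradients
      have hg1 : ‖fderiv ℝ (w k z.1) z.2 - fderiv ℝ (w k z.1) z'.2‖ ≤ K2 n * ‖z.2 - z'.2‖ :=
        (convex_univ.norm_image_sub_le_of_norm_fderiv_le
          (fun x _ => (hdiff2 k z.1 hzA) x)
          (fun x _ => hB2 n k hk z.1 ht x) (mem_univ z'.2) (mem_univ z.2))
      have hg2 : ‖fderiv ℝ (w k z.1) z'.2 - fderiv ℝ (w k z'.1) z'.2‖ ≤ L1 n * |z.1 - z'.1| := by
        have h := hL1 n hk (hc k) (hdivw k) (hmild k) (hI k) z'.1 ht' z.1 ht z'.2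
        rwa [norm_iteratedFDeriv_one_sub] at h
      have hgrad : ‖fderiv ℝ (w k z.1) z.2 - fderiv ℝ (w k z'.1) z'.2‖ ≤
          (K2 n + L1 n) * dist z z' := by
        calc ‖fderiv ℝ (w k z.1) z.2 - fderiv ℝ (w k z'.1) z'.2‖
            ≤ ‖fderiv ℝ (w k z.1) z.2 - fderiv ℝ (w k z.1) z'.2‖ +
                ‖fderiv ℝ (w k z.1) z'.2 - fderiv ℝ (w k z'.1) z'.2‖ :=
              norm_sub_le_norm_sub_add_norm_sub _ _ _
          _ ≤ K2 n * dist z z' + L1 n * dist z z' := add_le_add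
              (hg1.trans (mul_le_mul_of_nonneg_left hdx (hK2nn n)))
              (hg2.trans (mul_le_mul_of_nonneg_left hdt (hL10 n)))
          _ = (K2 n + L1 n) * dist z z' := by ring
      rw [hV, dist_eq_norm, Prod.mk_sub_mk, Prod.norm_mk]
      refine max_le (hval.trans ?_) (hgrad.trans ?_)
      · exact mul_le_mul_of_nonneg_right (by linarith [hK2nn n, hL10 n]) hd0
      · exact mul_le_mul_of_nonneg_right (by linarith [hK1nn n, hL00 n]) hd0
  -- ## Step 3: extraction
  obtain ⟨φ, hφ, P, hP⟩ := exists_strictMono_tendstoUniformlyOn_of_bound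
    (fun n => isCompact_slabPiece (E := EuclideanSpace ℝ (Fin 3)) n)
    (fun n => by linarith [hK1nn n, hL00 n, hK2nn n, hL10 n]) (fun _ => one_pos) hVn
  set W : ℝ → EuclideanSpace ℝ (Fin 3) → EuclideanSpace ℝ (Fin 3) := fun t x => (P (t, x)).1 with hWdef
  set G : ℝ → EuclideanSpace ℝ (Fin 3) → (EuclideanSpace ℝ (Fin 3) →L[ℝ] EuclideanSpace ℝ (Fin 3)) :=
    fun t x => (P (t, x)).2 with hGdef
  have hW0 : ∀ n, TendstoUniformlyOn (fun j z => w (φ j) z.1 z.2) (fun z => W z.1 z.2) atTop (T n) :=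
    fun n => by
    have h := uniformContinuous_fst.comp_tendstoUniformlyOn (hP n)
    exact (h.congr (Eventually.of_forall fun j => fun z _ => rfl)).congr_right fun z _ => rfl
  have hG0 : ∀ n, TendstoUniformlyOn (fun j z => fderiv ℝ (w (φ j) z.1) z.2) (fun z => G z.1 z.2) atTop
      (T n) := fun n => by
    have h := uniformContinuous_snd.comp_tendstoUniformlyOn (hP n)
    exact (h.congr (Eventually.of_forall fun j => fun z _ => rfl)).congr_right fun z _ => rfl
  have hφt : Tendsto φ atTop atTop := hφ.tendsto_atTop
  have hAφ : Tendsto (fun j => A (φ j)) atTop atBot := hA.comp hφt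
  -- eventually (in `j`) the level `s` is inside the window of `w (φ j)`
  have hlev : ∀ s : ℝ, ∃ j₀ : ℕ, ∀ j, j₀ ≤ j → A (φ j) < s := fun s =>
    eventually_atTop.1 (hAφ.eventually (eventually_lt_atBot s))
  -- continuity of the limit on the open slab
  have hWc : ContinuousOn (uncurry W) (Iio 0 ×ˢ univ) := by
    have hVφ : ∀ n, ∀ᶠ j in atTop, ContinuousOn (fun z : ℝ × EuclideanSpace ℝ (Fin 3) => w (φ j) z.1 z.2)
        (T n) := fun n => by
      filter_upwards [hφt.eventually (hAa n)] with j hj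
      exact (hc (φ j)).mono fun z hz => ⟨hTA n (φ j) hj z hz, mem_univ _⟩
    exact (continuousOn_slab_of_tendstoUniformlyOn hVφ hW0).congr fun z _ => rfl
  -- pointwise convergence of values and gradients
  have hpt : ∀ t < 0, ∀ x, Tendsto (fun j => w (φ j) t x) atTop (𝓝 (W t x)) := fun t ht x =>
    tendsto_of_tendstoUniformlyOn_slabPiece hW0 ht x
  have hptG : ∀ t < 0, ∀ x, Tendsto (fun j => fderiv ℝ (w (φ j) t) x) atTop (𝓝 (G t x)) :=
    fun t ht x => tendsto_of_tendstoUniformlyOn_slabPiece hG0 ht x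
  -- slice-wise locally uniform convergence
  have hlu : ∀ t < 0, TendstoLocallyUniformly (fun j => w (φ j) t) (W t) atTop := fun t ht =>
    tendstoLocallyUniformly_slice_of_tendstoUniformlyOn_slabPiece hW0 ht
  have hluG : ∀ t < 0, TendstoLocallyUniformly (fun j => fderiv ℝ (w (φ j) t)) (G t) atTop :=
    fun t ht => tendstoLocallyUniformly_slice_of_tendstoUniformlyOn_slabPiece hG0 ht
  -- the limit of the gradients is the gradient of the limit (shift past the window entrance)
  have hWD : ∀ t < 0, ∀ x, HasFDerivAt (W t) (G t x) x := by
    intro t ht x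
    obtain ⟨j₀, hj₀⟩ := hlev t
    have hG0' : ∀ n, TendstoUniformlyOn (fun j z => fderiv ℝ (w (φ (j + j₀)) z.1) z.2)
        (fun z => G z.1 z.2) atTop (T n) := fun n => tendstoUniformlyOn_shift (hG0 n) j₀
    have hluG' : TendstoLocallyUniformly (fun j => fderiv ℝ (w (φ (j + j₀)) t)) (G t) atTop :=
      tendstoLocallyUniformly_slice_of_tendstoUniformlyOn_slabPiece hG0' ht
    refine hasFDerivAt_of_tendstoLocallyUniformlyOn isOpen_univ hluG'.tendstoLocallyUniformlyOn
      (fun j y _ => ((hdiff (φ (j + j₀)) t ⟨hj₀ _ (Nat.le_add_left _ _), ht⟩) y).hasFDerivAt)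
      (fun y _ => (hpt t ht y).comp (tendsto_add_atTop_nat j₀)) (mem_univ x)
  have hWG : ∀ t < 0, ∀ x, fderiv ℝ (W t) x = G t x := fun t ht x => (hWD t ht x).fderiv
  -- ## Step 4a: weak divergence-freeness of the limit slices
  have hWdiv : ∀ t < 0, IsWeaklyDivFree (W t) := by
    intro t ht θ hθ
    obtain ⟨j₀, hj₀⟩ := hlev t
    have hev : ∀ᶠ j in atTop, A (φ j) < t := eventually_atTop.2 ⟨j₀, hj₀⟩
    have hθ1 : ContDiff ℝ 1 θ := contDiff_infty.1 hθ.contDiff 1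
    have hgc : HasCompactSupport (gradient θ) := by
      have : gradient θ = (fun L => (InnerProductSpace.toDual ℝ (EuclideanSpace ℝ (Fin 3))).symm L) ∘
          fderiv ℝ θ := rfl
      rw [this]
      exact (hθ.hasCompactSupport.fderiv (𝕜 := ℝ)).comp_left (by simp)
    set Mt : ℝ := C / Real.sqrt (-t) with hMt
    have hθi : Integrable (fun x => Mt * ‖gradient θ x‖) volume :=
      (((continuous_gradient_of_contDiff hθ1).integrable_of_hasCompactSupport hgc).norm).const_mul Mt
    have hlimθ : Tendsto (fun j => ∫ x, ⟪w (φ j) t x, gradient θ x⟫_ℝ) atTop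
        (𝓝 (∫ x, ⟪W t x, gradient θ x⟫_ℝ)) := by
      refine tendsto_integral_filter_of_dominated_convergence (fun x => Mt * ‖gradient θ x‖)
        ?_ ?_ hθi (Eventually.of_forall fun x => (hpt t ht x).inner tendsto_const_nhds)
      · filter_upwards [hev] with j hj
        exact ((hslice (φ j) t ⟨hj, ht⟩).inner (continuous_gradient_of_contDiff hθ1)).aestronglyMeasurable
      · filter_upwards [hev] with j hj
        exact Eventually.of_forall fun x =>
          (norm_inner_le_norm _ _).trans
            (mul_le_mul_of_nonneg_right (hI (φ j) t ⟨hj, ht⟩ x) (norm_nonneg _))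
    have hzero : ∀ᶠ j in atTop, (0 : ℝ) = ∫ x, ⟪w (φ j) t x, gradient θ x⟫_ℝ := by
      filter_upwards [hev] with j hj
      exact (hdivw (φ j) t ⟨hj, ht⟩ θ hθ).symm
    exact tendsto_nhds_unique hlimθ (tendsto_const_nhds.congr' hzero)
  -- ## Step 4b: the Type-I bound of the limit
  have hWI : HasTypeITimeDecay C W := by
    intro t ht x
    obtain ⟨j₀, hj₀⟩ := hlev t
    exact le_of_tendsto (hpt t ht x).norm
      (eventually_atTop.2 ⟨j₀, fun j hj => hI (φ j) t ⟨hj₀ j hj, ht⟩ x⟩)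
  -- ## Step 5: the Oseen identity in the limit (shift past the window entrance at level `s`)
  have hWmild : ∀ s t : ℝ, s < t → t < 0 → ∀ x,
      W t x = UnboundedOperators.heatExtension (W s) (t - s) x - oseenDuhamel 1 s W W t x := by
    intro s t hst ht x
    have hs0 : s < 0 := hst.trans ht
    obtain ⟨j₀, hj₀⟩ := hlev s
    set u : ℕ → ℝ → EuclideanSpace ℝ (Fin 3) → EuclideanSpace ℝ (Fin 3) := fun j => w (φ (j + j₀)) with hu
    have hAu : ∀ j, A (φ (j + j₀)) < s := fun j => hj₀ _ (Nat.le_add_left _ _)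
    have hptu : ∀ τ < 0, ∀ y, Tendsto (fun j => u j τ y) atTop (𝓝 (W τ y)) := fun τ hτ y =>
      (hpt τ hτ y).comp (tendsto_add_atTop_nat j₀)
    set M₀ : ℝ := C / Real.sqrt (-t) with hM₀
    have hM₀0 : 0 ≤ M₀ := by rw [hM₀]; positivity
    have huM : ∀ j, ∀ τ ∈ Ioo s t, ∀ y, ‖u j τ y‖ ≤ M₀ := fun j τ hτ y =>
      (hI _ τ ⟨(hAu j).trans hτ.1, hτ.2.trans ht⟩ y).trans
        (div_sqrt_neg_le hC (neg_pos.2 ht) (by linarith [hτ.2]))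
    have hum : ∀ j, AEStronglyMeasurable (uncurry (u j))
        ((volume : Measure (ℝ × EuclideanSpace ℝ (Fin 3))).restrict (Ioo s t ×ˢ univ)) := fun j =>
      ((hc _).mono (prod_mono (fun τ hτ => ⟨(hAu j).trans hτ.1, hτ.2.trans ht⟩) Subset.rfl)).aestronglyMeasurable
        (measurableSet_Ioo.prod MeasurableSet.univ)
    have hWm : AEStronglyMeasurable (uncurry W)
        ((volume : Measure (ℝ × EuclideanSpace ℝ (Fin 3))).restrict (Ioo s t ×ˢ univ)) :=
      (hWc.mono (prod_mono (fun τ hτ => hτ.2.trans ht) Subset.rfl)).aestronglyMeasurable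
        (measurableSet_Ioo.prod MeasurableSet.univ)
    have hD : Tendsto (fun j => oseenDuhamel 1 s (u j) (u j) t x) atTop (𝓝 (oseenDuhamel 1 s W W t x)) :=
      tendsto_oseenDuhamel_of_tendsto_of_bound one_pos hM₀0 hst hum hWm huM
        (fun τ hτ y => hptu τ (hτ.2.trans ht) y) x
    have hH : Tendsto (fun j => UnboundedOperators.heatExtension (u j s) (t - s) x) atTop
        (𝓝 (UnboundedOperators.heatExtension (W s) (t - s) x)) :=
      tendsto_heatExtension_of_tendsto_of_bound (M := C / Real.sqrt (-s))
        (fun j => (hslice _ s ⟨hAu j, hs0⟩).aestronglyMeasurable) (fun j z => hI _ s ⟨hAu j, hs0⟩ z)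
        (hptu s hs0) (sub_pos.2 hst) x
    have hid : (fun j => u j t x) = fun j =>
        UnboundedOperators.heatExtension (u j s) (t - s) x - oseenDuhamel 1 s (u j) (u j) t x :=
      funext fun j => hmild _ s t (hAu j) hst ht x
    have hlim2 : Tendsto (fun j => u j t x) atTop
        (𝓝 (UnboundedOperators.heatExtension (W s) (t - s) x - oseenDuhamel 1 s W W t x)) := by
      rw [hid]; exact hH.sub hD
    exact tendsto_nhds_unique (hptu t ht x) hlim2
  -- ## Conclusion
  have hWclass : IsTypeIAncientMild C W := isTypeIAncientMild_of_continuous_oseenMild hWc hWdiv hWmild hWI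
  refine ⟨φ, hφ, W, hWclass, hpt, fun t ht x => ?_, hlu, fun t ht => ?_⟩
  · rw [hWG t ht x]; exact hptG t ht x
  · have e : fderiv ℝ (W t) = G t := funext fun x => hWG t ht x
    rw [e]; exact hluG t ht

end Compactness

end Literature.Analysis.NavierStokesZoomKit

end Part6

/-!
## Part 7 — port of `Summits/NavierStokesRegularity/NavierStokesRegularity/Theorems/ScaledTopAlignmentTypeIZoomNonAlignedLimitZoom.lean` (2 declarations kept)

# Route `ScaledTopAlignment`, crux GAP″ = `TypeIZoomNonAlignedLimit` (stmt-NavierStokesRegularity-19902):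
# the zoom step — a Type-I blow-up has a NON-TRIVIAL Type-I ancient mild zoom limit whose slice
# vorticities are pointwise limits of parabolic vorticity zooms with moving centres

This is the compactness half ("Z", p3's `stub_zoomProfile` / `stub_zoomSlices`, GapSkeleton2.lean
attached to the item 2026-08-25T20:56Z) of the crux `TypeIZoomNonAlignedLimit`, proved over the
tree's Type-I ancient mild class `IsTypeIAncientMild C W` (KNSS/Oseen gauge) instead of p3's inline
`IsOseenTypeIProfile` (whose extra clause "`W` bounded on all of `(-∞,0) × ℝ³`" is not inherited by
Type-I zoom limits and is not used by the rigidity half):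

* `typeIZoom_ancientMild_limit` — for `ν > 0`, `T > 0`, a classical solution `(u, p)` on `ℝ³ × [0,T)`,
  Leray–Hopf from `u 0`, bounded on every closed sub-strip, with the Type-I rate at `T`
  (`IsTypeIBlowup u T`) and NO smooth extension past `T`, there are `C`, a field `W` with
  `IsTypeIAncientMild C W` and `W(−1, 0) ≠ 0`, and for every `s < 0` centres `x_j`, times
  `t_j ∈ [0, T)` and scales `λ_j → 0⁺` with
  `(λ_j²/ν) ω(t_j, x_j + λ_j y) → curl W(s) (y)` for every `y` (`ω = curl u`).

## Proof (KNSS 2009 §6 / Seregin–Šverák 2009 / Giga–Miura 2011 Prop. 2.1–2.2, with Leray's rate)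

1. Leray's lower bound (tree theorem `leray_blowup_rate_top_holds`, Leray 1934 §19 (3.9)):
   `‖u(t)‖_∞ ≥ c₀√ν/√(T − t)` for every `t < T` since `u` is maximal; as `u(t)` is continuous there
   are points `x_k` with `‖u(t_k, x_k)‖ ≥ c₀√ν/(2√(T − t_k))` at the times `t_k = T − c_k² T`,
   `c_k = 1/(k+2)`.
2. The global rate `√(T − t)‖u(t, x)‖ ≤ C₁` on `(0, T)` (Type I near `T`, slab bound before).
3. The viscosity-normalising zooms `w_k(s, y) = c_k α u(T + c_k² β s, x_k + c_k R y)`, `R = √(νT)`,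
   `α = R/ν`, `β = R²/ν = T`, about the MOVING centres `(T, x_k)` are jointly continuous, weakly
   divergence free, Oseen-mild (`zoom_oseen_of_slab`) on the windows `(−1/c_k², 0)`, and obey the
   common Type-I bound `(αC₁/√β)/√(−s)` (`zoom_norm_le`); `‖w_k(−1, 0)‖ ≥ c₀/2`.
4. `exists_tendsto_of_typeI_seq_Ioo` (KNSS 2009 Lemma 6.1 + Prop. 4.1, the tree's `C¹_loc`
   compactness on growing windows): along a subsequence `w_k → W`, `∇w_k → ∇W` pointwise on `t < 0`,
   `IsTypeIAncientMild C W`; hence `‖W(−1, 0)‖ ≥ c₀/2` and, since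
   `curl w_k(s)(y) = ((c_k R)²/ν) ω(T + c_k²βs, x_k + c_k R y)` (`curl_smul_stPull`) and `curl` is a
   linear function of the gradient (`curlCLM`), the vorticity zooms converge to `curl W(s)`.

Not carried from this source module (not needed by the declarations re-homed here; their consumers are Summits-side): `typeIZoom_ancientMild_limit`.
-/

section Part7

open _root_.MeasureTheory _root_.Set _root_.Function _root_.Filter _root_.TopologicalSpace _root_.Metric
open scoped _root_.Topology _root_.NNReal _root_.ENNReal _root_.InnerProductSpace RealInnerProductSpace

namespace Literature.Analysis.NavierStokesZoomKit

open Literature.Analysis Literature.Analysis.FluidPDE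

section LerayPoints

variable {ν T : ℝ} {u : ℝ → EuclideanSpace ℝ (Fin 3) → EuclideanSpace ℝ (Fin 3)}
  {p : ℝ → EuclideanSpace ℝ (Fin 3) → ℝ}

/-- **Near-maximum points carry Leray's rate.** For a classical solution on `[0, T)` which is
Leray–Hopf from `u 0`, bounded on every closed sub-strip and does not extend smoothly past `T`,
at every `t ∈ [0, T)` there is a point `x` with `‖u(t, x)‖ ≥ c₀√ν/√(T − t)/2`, where `c₀ > 0` is
Leray's universal constant (`leray_blowup_rate_top_holds`: `‖u(t)‖_∞ ≥ c₀√ν (T−t)^{-1/2}`; the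
slice is continuous, so the essential supremum is approached by values). [cite: Leray1934, §19 (3.8)–(3.9) p. 224] -/
theorem exists_lerayRate_points (hν : 0 < ν) (hT : 0 < T)
    (hsol : IsClassicalNSSolutionOn (Ico 0 T) ν 0 u p) (hLH : IsLerayHopfOn T ν 0 (u 0) u)
    (hbdd : ∀ T₁ ∈ Ioo 0 T, ∃ M : ℝ, ∀ t ∈ Icc 0 T₁, ∀ x, ‖u t x‖ ≤ M)
    (hext : ¬ HasSmoothExtensionPast ν 0 u T) :
    ∃ c₀ : ℝ, 0 < c₀ ∧ ∀ t ∈ Ico 0 T, ∃ x : EuclideanSpace ℝ (Fin 3),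
      c₀ * Real.sqrt ν / Real.sqrt (T - t) / 2 ≤ ‖u t x‖ := by
  obtain ⟨c₀, hc₀, hLeray⟩ := leray_blowup_rate_top_holds
  refine ⟨c₀, hc₀, fun t ht => ?_⟩
  have hstrip : ∀ T' ∈ Ioo 0 T,
      eLpNorm (uncurry u) ∞ (volume.restrict (Icc 0 T' ×ˢ univ)) < ∞ := by
    intro T' hT'
    obtain ⟨M, hM⟩ := hbdd T' hT'
    refine lt_of_le_of_lt ?_ (ENNReal.ofReal_lt_top (r := M))
    rw [eLpNorm_exponent_top]
    refine eLpNormEssSup_le_of_ae_bound ?_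
    rw [ae_restrict_iff' (measurableSet_Icc.prod MeasurableSet.univ)]
    exact Eventually.of_forall fun z hz => hM z.1 (mem_prod.1 hz).1 z.2
  have hle := hLeray ν T hν hT u p ⟨hsol, hext⟩ hLH hstrip t ht
  by_contra hno
  push Not at hno
  have hsq : 0 < Real.sqrt (T - t) := Real.sqrt_pos.2 (sub_pos.2 ht.2)
  have hpos : 0 < c₀ * Real.sqrt ν / Real.sqrt (T - t) := by positivity
  have hbd : eLpNorm (u t) ∞ volume ≤ ENNReal.ofReal (c₀ * Real.sqrt ν / Real.sqrt (T - t) / 2) := by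
    rw [eLpNorm_exponent_top]
    exact eLpNormEssSup_le_of_ae_bound (Eventually.of_forall fun x => (hno x).le)
  have hlt : ENNReal.ofReal (c₀ * Real.sqrt ν / Real.sqrt (T - t) / 2) <
      ENNReal.ofReal (c₀ * Real.sqrt ν / Real.sqrt (T - t)) := by
    rw [ENNReal.ofReal_lt_ofReal_iff hpos]
    exact half_lt_self hpos
  exact absurd (hle.trans hbd) (not_le.2 hlt)

/-- **The global rate of a Type-I classical solution bounded on closed sub-strips**: if
`IsTypeIBlowup u T` and `u` is bounded on every `[0, T₁] × ℝ³`, `T₁ < T`, then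
`√(T − t)‖u(t, x)‖ ≤ C₁` for all `0 < t < T` and some `C₁` (Type I near `T`, the slab bound before). [folklore]
[cite: KochNadirashviliSereginSverak2009, §§2–3 (source of the Type-I rescaling / ancient mild limit argument this module implements; this declaration is the cell’s own lemma, NOT a printed statement)] -/
theorem exists_global_typeI_rate (hT : 0 < T)
    (hbdd : ∀ T₁ ∈ Ioo 0 T, ∃ M : ℝ, ∀ t ∈ Icc 0 T₁, ∀ x, ‖u t x‖ ≤ M) (hI : IsTypeIBlowup u T) :
    ∃ C₁ : ℝ, ∀ t ∈ Ioo (T - T) T, ∀ x, Real.sqrt (T - t) * ‖u t x‖ ≤ C₁ := by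
  obtain ⟨CI, hCI⟩ := hI
  obtain ⟨l, hlT, hl⟩ := mem_nhdsLT_iff_exists_Ioo_subset.1 hCI
  set T₀ : ℝ := (max l 0 + T) / 2 with hT₀
  have hlT' : max l 0 < T := max_lt hlT hT
  have hT₀0 : 0 < T₀ := by rw [hT₀]; linarith [le_max_right l 0]
  have hT₀T : T₀ < T := by rw [hT₀]; linarith
  have hlT₀ : l < T₀ := by rw [hT₀]; linarith [le_max_left l 0]
  obtain ⟨M₀, hM₀⟩ := hbdd T₀ ⟨hT₀0, hT₀T⟩
  refine ⟨max CI (Real.sqrt T * M₀), fun t ht x => ?_⟩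
  rw [sub_self] at ht
  rcases le_or_gt t T₀ with htl | htg
  · refine le_trans ?_ (le_max_right _ _)
    exact mul_le_mul (Real.sqrt_le_sqrt (by linarith [ht.1])) (hM₀ t ⟨ht.1.le, htl⟩ x)
      (norm_nonneg _) (Real.sqrt_nonneg _)
  · refine le_trans ?_ (le_max_left _ _)
    have hsq : 0 < Real.sqrt (T - t) := Real.sqrt_pos.2 (sub_pos.2 ht.2)
    have h := hl ⟨hlT₀.trans htg, ht.2⟩ x
    rwa [le_div_iff₀ hsq, mul_comm] at h

end LerayPoints

section Zoom

variable {ν T : ℝ} {u : ℝ → EuclideanSpace ℝ (Fin 3) → EuclideanSpace ℝ (Fin 3)}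
  {p : ℝ → EuclideanSpace ℝ (Fin 3) → ℝ}

end Zoom

end Literature.Analysis.NavierStokesZoomKit

end Part7

/-!
## Part 8 — port of `Summits/NavierStokesRegularity/NavierStokesRegularity/Theorems/ScaledTopAlignmentFlexibleZoom.lean` (1 declarations kept)

# Route `ScaledTopAlignment`: the FLEXIBLE Type-I zoom — caller-chosen base times, diagonal slice
# convergence — in a module that does NOT import the route file (support for the deciding crux
# W3ʷᵇ = `AprioriWindowBulkAlignment`, stmt-NavierStokesRegularity-19447, and its most-times weakening)

The route's Type-I zoom (`typeIZoom_ancientMild_limit`, KNSS 2009 §6 rescaling about Leray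
near-maximum points + the tree's `C¹_loc` compactness `exists_tendsto_of_typeI_seq_Ioo`) is
re-proved here with two freedoms the glue of a MOST-TIMES door needs (planner p3, ROUND-5 T-5.1):

* **caller-chosen base times.** The zooms are centred at `(T, x_j)` with scales `c_j² T = T − τ_j`
  for ANY sequence of times `τ_j ∈ [0, T)`, `τ_j → T`, supplied by the caller (`x_j` a Leray
  near-maximum point of `u(τ_j)`), so that the slice `s = −1` of the `j`-th zoom reads the solution
  at the time `τ_j` exactly; non-triviality `W(−1, 0) ≠ 0` of the limit comes from Leray's rate at
  these times.
* **diagonal slice convergence.** Along the extracted subsequence the vorticity zooms converge to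
  `curl W(s)` not only on the fixed slice `s` but along ANY sequence of slices `σ_j → s`
  (`tendsto_fderiv_slice_diag`): the spatial gradients of continuous Type-I Oseen-mild fields are
  Lipschitz in time on compact windows, uniformly over the family (KNSS 2009, (4.11), tree
  `exists_lipschitz_time_of_typeI_Ioo`), so moving the slice by `σ_j − s → 0` costs nothing.

Main statement `typeIZoom_ancientMild_limit_flexible` (constant slices `σ_j = s` recover the
PARABOLIC form `typeIZoom_ancientMild_limit_parabolic` of `ScaledTopAlignmentGigaMiuraTypeI` = the
route's support binder GAP‴ `TypeIParabolicZoomLimit`, stmt-19596); this module's import cone avoids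
`Theses.ScaledTopAlignment`, so the route's `closes` may cite it.
WHAT THIS IS NOT: not NS regularity; a compactness statement about Type-I blow-ups (which the
residual hard core NoTypeII says are the only ones).

## References
* G. Koch, N. Nadirashvili, G. Seregin, V. Šverák, Acta Math. 203 (2009) 83–105 = arXiv:0709.3599:
  §4 Prop. 4.1 with (4.10)–(4.11) (p. 8), §6 Lemma 6.1 and proof of Thm 6.2 (pp. 11–13).
  [KochNadirashviliSereginSverak2009]
* J. Leray, Acta Math. 63 (1934) 193–248, §19 (3.9). [Leray1934]
* Y. Giga, H. Miura, Comm. Math. Phys. 303 (2011) 289–300, §2.1 (the blow-up sequence). [GigaMiura2011]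

Not carried from this source module (not needed by the declarations re-homed here; their consumers are Summits-side): `typeIZoom_ancientMild_limit_flexible`.
-/

section Part8

open _root_.MeasureTheory _root_.Set _root_.Function _root_.Filter _root_.TopologicalSpace _root_.Metric
open scoped _root_.Topology _root_.NNReal _root_.ENNReal _root_.InnerProductSpace RealInnerProductSpace

namespace Literature.Analysis.NavierStokesZoomKit

open Literature.Analysis Literature.Analysis.FluidPDE

section Diagonal

/-- **Diagonal slice convergence of gradients.** Let `w k` be continuous Type-I Oseen-mild fields
on growing final windows `(A k, 0)`, `A k → −∞`, with a common Type-I constant `C` (the hypotheses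
of `exists_tendsto_of_typeI_seq_Ioo`). If at a slice `s < 0` and a point `x` the gradients
`D(w k s)(x)` converge to `L`, then so do the gradients `D(w k (σ k))(x)` along any sequence of
slices `σ k → s`: by KNSS 2009 (4.11) (tree `exists_lipschitz_time_of_typeI_Ioo`) the gradients are
Lipschitz in time on a window around `s`, uniformly in `k`. [cite: KochNadirashviliSereginSverak2009, §4 (4.11) with Prop. 4.1 (arXiv:0709.3599 p. 8)] -/
theorem tendsto_fderiv_slice_diag (C : ℝ) {A : ℕ → ℝ} (hA : Tendsto A atTop atBot)
    {w : ℕ → ℝ → EuclideanSpace ℝ (Fin 3) → EuclideanSpace ℝ (Fin 3)}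
    (hc : ∀ k, ContinuousOn (uncurry (w k)) (Ioo (A k) 0 ×ˢ univ))
    (hdivw : ∀ k, ∀ t ∈ Ioo (A k) 0, IsWeaklyDivFree (w k t))
    (hmild : ∀ k, ∀ s t : ℝ, A k < s → s < t → t < 0 → ∀ x,
      w k t x = UnboundedOperators.heatExtension (w k s) (t - s) x - oseenDuhamel 1 s (w k) (w k) t x)
    (hI : ∀ k, ∀ t ∈ Ioo (A k) 0, ∀ x, ‖w k t x‖ ≤ C / Real.sqrt (-t))
    {s : ℝ} (hs : s < 0) {x : EuclideanSpace ℝ (Fin 3)}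
    {L : EuclideanSpace ℝ (Fin 3) →L[ℝ] EuclideanSpace ℝ (Fin 3)}
    (hlim : Tendsto (fun k => fderiv ℝ (w k s) x) atTop (𝓝 L))
    {σ : ℕ → ℝ} (hσ : Tendsto σ atTop (𝓝 s)) :
    Tendsto (fun k => fderiv ℝ (w k (σ k)) x) atTop (𝓝 L) := by
  -- a window `[s - 1, s/2) ∋ s` inside `(s - 2, s/2)`
  have hab : s - 2 < s / 2 := by linarith
  have hb : s / 2 < 0 := by linarith
  obtain ⟨Lip, -, hLip⟩ := exists_lipschitz_time_of_typeI_Ioo C 1 hab hb one_pos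
  have hsmem : s ∈ Ico (s - 2 + 1) (s / 2) := ⟨by linarith, by linarith⟩
  have hAk : ∀ᶠ k in atTop, A k < s - 2 := hA.eventually (eventually_lt_atBot _)
  have hσk : ∀ᶠ k in atTop, σ k ∈ Ico (s - 2 + 1) (s / 2) := by
    have h : Ioo (s - 1) (s / 2) ∈ 𝓝 s := Ioo_mem_nhds (by linarith) (by linarith)
    filter_upwards [hσ.eventually (eventually_mem_set.2 h)] with k hk
    exact ⟨by linarith [hk.1], hk.2⟩
  have hdiff : Tendsto (fun k => fderiv ℝ (w k (σ k)) x - fderiv ℝ (w k s) x) atTop (𝓝 0) := by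
    refine squeeze_zero_norm' ?_ ?_ (a := fun k => Lip * |σ k - s|)
    · filter_upwards [hAk, hσk] with k hk hσk'
      have h := hLip hk (hc k) (hdivw k) (hmild k) (hI k) s hsmem (σ k) hσk' x
      rwa [norm_iteratedFDeriv_one_sub] at h
    · have h : Tendsto (fun k => Lip * |σ k - s|) atTop (𝓝 (Lip * |s - s|)) :=
        ((hσ.sub_const s).abs).const_mul Lip
      simpa using h
  simpa using hdiff.add hlim

end Diagonal

section Zoom

variable {ν T : ℝ} {u : ℝ → EuclideanSpace ℝ (Fin 3) → EuclideanSpace ℝ (Fin 3)}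
  {p : ℝ → EuclideanSpace ℝ (Fin 3) → ℝ}

end Zoom

end Literature.Analysis.NavierStokesZoomKit

end Part8

/-!
## Part 9 — port of `Summits/NavierStokesRegularity/NavierStokesRegularity/Theorems/ScaledTopAlignmentFlexibleZoomLU.lean` (1 declarations kept)

# Route `ScaledTopAlignment`: the flexible Type-I zoom WITH LOCALLY UNIFORM slice convergence of the
# vorticity zooms (support for the deciding crux W3ᵐᵗ = `AprioriMostTimesBulkAlignment`,
# stmt-NavierStokesRegularity-19551; no import of the route file)

The tree's `typeIZoom_ancientMild_limit_flexible` (`ScaledTopAlignmentFlexibleZoom`: KNSS 2009 §6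
rescaling about Leray near-maximum points at caller-chosen base times, `C¹_loc` compactness
`exists_tendsto_of_typeI_seq_Ioo`, diagonal slices) exports the convergence of the vorticity zooms
`(λ_j²/ν) ω(T + λ_j² s/ν, x_j + λ_j y) → curl W(s)(y)` POINTWISE in `y`. The compactness theorem it
rests on proves more — the spatial gradients of the zooms converge LOCALLY UNIFORMLY on every slice
(KNSS 2009, Prop. 4.1 / (4.10)–(4.11): window-uniform `C²` bounds, Arzelà–Ascoli) — and consumers that
must control the zoomed vorticity on a whole ball at once (e.g. to keep a segment inside a top region
`{|ω| > d}` before applying a mean-value inequality, as in the tree's discharge of Giga–Miura 2011,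
Cor. 2.6, `ScaledTopAlignmentGigaMiuraDirectionGradient`) need exactly that. This module re-runs the
construction and exports, in addition to everything `typeIZoom_ancientMild_limit_flexible` gives, the
locally uniform convergence of the vorticity zooms on every slice `s < 0`
(`typeIZoom_ancientMild_limit_flexible_locUnif`).
WHAT THIS IS NOT: not NS regularity; a compactness statement about Type-I blow-ups (which the
residual hard core NoTypeII says are the only ones).

## References
* G. Koch, N. Nadirashvili, G. Seregin, V. Šverák, Acta Math. 203 (2009) 83–105 = arXiv:0709.3599:
  §4 Prop. 4.1 with (4.10)–(4.11) (p. 8), §6 Lemma 6.1 and proof of Thm 6.2 (pp. 11–13).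
  [KochNadirashviliSereginSverak2009]
* J. Leray, Acta Math. 63 (1934) 193–248, §19 (3.9). [Leray1934]
* Y. Giga, H. Miura, Comm. Math. Phys. 303 (2011) 289–300, §2.1 (the blow-up sequence). [GigaMiura2011]
-/

section Part9

open _root_.MeasureTheory _root_.Set _root_.Function _root_.Filter _root_.TopologicalSpace _root_.Metric
open scoped _root_.Topology _root_.NNReal _root_.ENNReal _root_.InnerProductSpace RealInnerProductSpace

namespace Literature.Analysis.NavierStokesZoomKit

open Literature.Analysis Literature.Analysis.FluidPDE

section Zoom

variable {ν T : ℝ} {u : ℝ → EuclideanSpace ℝ (Fin 3) → EuclideanSpace ℝ (Fin 3)}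
  {p : ℝ → EuclideanSpace ℝ (Fin 3) → ℝ}

/-- **The flexible Type-I zoom limit, with locally uniform slice convergence.** For `ν > 0`, `T > 0`,
a classical solution `(u, p)` on `ℝ³ × [0, T)`, Leray–Hopf from `u 0`, bounded on every `[0, T'] × ℝ³`
(`T' < T`), with the Type-I rate at `T` and no smooth extension past `T`, and for ANY base times
`τ_j ∈ [0, T)`, `τ_j → T`: along a subsequence `φ` there are `C`, a Type-I ancient mild field `W`
(`IsTypeIAncientMild C W`) with `W(−1, 0) ≠ 0`, centres `x_j` and scales `λ_j > 0`,
`λ_j² = ν(T − τ_{φ j})`, `λ_j → 0`, such that (i) the slice `−1` is read at the caller's times —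
`(λ_j²/ν) ω(τ_{φ j}, x_j + λ_j y) → curl W(−1)(y)` for all `y`; (ii) for every `s < 0` and EVERY
sequence of slices `σ_j → s`, `(λ_j²/ν) ω(T + λ_j² σ_j/ν, x_j + λ_j y) → curl W(s)(y)` for all `y`;
and (iii) for every `s < 0` the vorticity zooms `y ↦ (λ_j²/ν) ω(T + λ_j² s/ν, x_j + λ_j y)` converge to
`curl W(s)` LOCALLY UNIFORMLY on `ℝ³` (KNSS 2009 §6 rescaling about Leray near-maximum points of
`u(τ_j)`, compactness `exists_tendsto_of_typeI_seq_Ioo` — whose locally uniform convergence of the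
gradients is composed with the linear map `curlCLM` — diagonal slices by `tendsto_fderiv_slice_diag`;
non-triviality from Leray's rate `‖u(t)‖_∞ ≥ c₀√ν/√(T − t)`).
[cite: KochNadirashviliSereginSverak2009, §6 Lemma 6.1 and proof of Thm 6.2 with Prop. 4.1 (arXiv:0709.3599 pp. 8, 11–13)] -/
theorem typeIZoom_ancientMild_limit_flexible_locUnif (hν : 0 < ν) (hT : 0 < T)
    (hsol : IsClassicalNSSolutionOn (Ico 0 T) ν 0 u p) (hLH : IsLerayHopfOn T ν 0 (u 0) u)
    (hslab : ∀ T' < T, ∃ M : ℝ, ∀ t ∈ Icc 0 T', ∀ x, ‖u t x‖ ≤ M)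
    (hI : IsTypeIBlowup u T) (hext : ¬ HasSmoothExtensionPast ν 0 u T)
    {τ : ℕ → ℝ} (hτ : ∀ j, τ j ∈ Ico 0 T) (hτT : Tendsto τ atTop (𝓝 T)) :
    ∃ φ : ℕ → ℕ, StrictMono φ ∧
      ∃ (C : ℝ) (W : ℝ → EuclideanSpace ℝ (Fin 3) → EuclideanSpace ℝ (Fin 3))
        (xc : ℕ → EuclideanSpace ℝ (Fin 3)) (lam : ℕ → ℝ),
        IsTypeIAncientMild C W ∧ W (-1) 0 ≠ 0 ∧ (∀ j, 0 < lam j) ∧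
        (∀ j, lam j ^ 2 = ν * (T - τ (φ j))) ∧ Tendsto lam atTop (𝓝 0) ∧
        (∀ y, Tendsto (fun j => (lam j ^ 2 / ν) • curl (u (τ (φ j))) (xc j + lam j • y)) atTop
          (𝓝 (curl (W (-1)) y))) ∧
        (∀ s < (0 : ℝ), ∀ σ : ℕ → ℝ, Tendsto σ atTop (𝓝 s) → ∀ y,
          Tendsto (fun j => (lam j ^ 2 / ν) • curl (u (T + lam j ^ 2 * σ j / ν)) (xc j + lam j • y))
            atTop (𝓝 (curl (W s) y))) ∧
        ∀ s < (0 : ℝ), TendstoLocallyUniformly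
          (fun j y => (lam j ^ 2 / ν) • curl (u (T + lam j ^ 2 * s / ν)) (xc j + lam j • y))
          (curl (W s)) atTop := by
  -- adapted from the tree's `typeIZoom_ancientMild_limit_flexible` (same construction; the locally
  -- uniform convergence of the gradients of `exists_tendsto_of_typeI_seq_Ioo` is kept and exported)
  have hbdd : ∀ T₁ ∈ Ioo 0 T, ∃ M : ℝ, ∀ t ∈ Icc 0 T₁, ∀ x, ‖u t x‖ ≤ M :=
    fun T₁ hT₁ => hslab T₁ hT₁.2
  -- Steps 1–2: Leray points and the global rate
  obtain ⟨c₀, hc₀, hlow⟩ := exists_lerayRate_points hν hT hsol hLH hbdd hext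
  obtain ⟨C₁, hrate⟩ := exists_global_typeI_rate (u := u) hT hbdd hI
  -- Step 3: scales `c_j² T = T - τ_j`
  set R : ℝ := Real.sqrt (ν * T) with hRdef
  have hR : 0 < R := Real.sqrt_pos.2 (mul_pos hν hT)
  have hR2 : R ^ 2 = ν * T := by rw [hRdef, Real.sq_sqrt (mul_pos hν hT).le]
  set α : ℝ := R / ν with hα
  set β : ℝ := R ^ 2 / ν with hβ
  have hν0 : ν ≠ 0 := hν.ne'
  have hβT : β = T := by
    rw [hβ, hR2]; field_simp
  have hβpos : 0 < β := by rw [hβT]; exact hT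
  have hTτ : ∀ k, 0 < T - τ k := fun k => sub_pos.2 (hτ k).2
  set c : ℕ → ℝ := fun k => Real.sqrt ((T - τ k) / T) with hcdef
  have hc : ∀ k, 0 < c k := fun k => by rw [hcdef]; exact Real.sqrt_pos.2 (div_pos (hTτ k) hT)
  have hc2 : ∀ k, c k ^ 2 * β = T - τ k := fun k => by
    rw [hcdef, Real.sq_sqrt (div_pos (hTτ k) hT).le, hβT]
    field_simp
  have hTτ0 : Tendsto (fun k => T - τ k) atTop (𝓝[>] 0) := by
    refine tendsto_nhdsWithin_iff.2 ⟨?_, Eventually.of_forall fun k => hTτ k⟩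
    have h := hτT.const_sub T
    rwa [sub_self] at h
  have hc0 : Tendsto c atTop (𝓝 0) := by
    have h1 : Tendsto (fun k => (T - τ k) / T) atTop (𝓝 0) := by
      have h := (tendsto_nhdsWithin_iff.1 hTτ0).1.div_const T
      rwa [zero_div] at h
    have h2 := (Real.continuous_sqrt.tendsto 0).comp h1
    rwa [Real.sqrt_zero] at h2
  -- the windows `(A k, 0)`, `A k = -(T/(c_k² β)) = -T/(T - τ_k) → -∞`
  set A : ℕ → ℝ := fun k => -(T / (c k ^ 2 * β)) with hAdef
  have hA : Tendsto A atTop atBot := by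
    have h1 : Tendsto (fun k => T / (T - τ k)) atTop atTop := by
      have h := (tendsto_inv_nhdsGT_zero.comp hTτ0).const_mul_atTop hT
      refine h.congr fun k => ?_
      simp only [comp_apply, div_eq_mul_inv]
    refine (tendsto_neg_atTop_atBot.comp h1).congr fun k => ?_
    simp only [hAdef, comp_apply, hc2 k]
  -- the near-maximum centres at the caller's times `τ_k = T + c_k² β (-1)`
  have htk : ∀ k, T + c k ^ 2 * β * (-1) = τ k := fun k => by rw [hc2 k]; ring
  choose xk hxk using fun k => hlow (τ k) (hτ k)
  -- the zooms
  set w : ℕ → ℝ → EuclideanSpace ℝ (Fin 3) → EuclideanSpace ℝ (Fin 3) :=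
    fun k => (c k * α) • stPull (c k ^ 2 * β) (c k * R) T (xk k) u with hwdef
  have hcw : ∀ k, ContinuousOn (uncurry (w k)) (Ioo (A k) 0 ×ˢ univ) := fun k =>
    zoom_continuousOn (x₀ := xk k) hν hsol hR hα hβ (hc k) le_rfl
  have hdivw : ∀ k, ∀ t ∈ Ioo (A k) 0, IsWeaklyDivFree (w k t) := fun k t ht =>
    zoom_isWeaklyDivFree (x₀ := xk k) hν hsol hR hα hβ (hc k) le_rfl ht
  have hmild : ∀ k, ∀ s t : ℝ, A k < s → s < t → t < 0 → ∀ x,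
      w k t x = UnboundedOperators.heatExtension (w k s) (t - s) x -
        oseenDuhamel 1 s (w k) (w k) t x := fun k s t hs hst ht x =>
    zoom_oseen_of_slab (x₀ := xk k) hν hT hsol hLH hbdd hR hα hβ (hc k) le_rfl hs hst ht x
  have hIw : ∀ k, ∀ t ∈ Ioo (A k) 0, ∀ x, ‖w k t x‖ ≤ (α * C₁ / Real.sqrt β) / Real.sqrt (-t) :=
    fun k t ht x => zoom_norm_le (T := T) (x₀ := xk k) (u := u) hR hα hβ hν (hc k) le_rfl hrate ht x
  -- Step 4: extraction
  obtain ⟨φ, hφ, W, hW, hpt, hptD, -, hLUD⟩ :=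
    exists_tendsto_of_typeI_seq_Ioo (α * C₁ / Real.sqrt β) hA hcw hdivw hmild hIw
  have hφt : Tendsto φ atTop atTop := hφ.tendsto_atTop
  -- Step 5: non-triviality at `(-1, 0)`
  have hsqrt : ∀ k, Real.sqrt (T - τ k) = c k * Real.sqrt T := fun k => by
    have e : T - τ k = (c k) ^ 2 * T := by rw [← hc2 k, hβT]
    rw [e, Real.sqrt_mul (sq_nonneg _), Real.sqrt_sq (hc k).le]
  have hkey : ∀ k, c k * α * (c₀ * Real.sqrt ν / Real.sqrt (T - τ k) / 2) = c₀ / 2 := fun k => by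
    rw [hsqrt k, hα, hRdef, Real.sqrt_mul hν.le]
    have hsν : Real.sqrt ν ≠ 0 := (Real.sqrt_pos.2 hν).ne'
    have hsT : Real.sqrt T ≠ 0 := (Real.sqrt_pos.2 hT).ne'
    have hck : c k ≠ 0 := (hc k).ne'
    have e1 : Real.sqrt ν * Real.sqrt T / ν = Real.sqrt T / Real.sqrt ν := by
      rw [div_eq_div_iff hν0 hsν]
      calc Real.sqrt ν * Real.sqrt T * Real.sqrt ν
          = Real.sqrt T * (Real.sqrt ν * Real.sqrt ν) := by ring
        _ = Real.sqrt T * ν := by rw [Real.mul_self_sqrt hν.le]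
    rw [e1]
    field_simp
  have hwk : ∀ k, c₀ / 2 ≤ ‖w k (-1) 0‖ := fun k => by
    have e : w k (-1) 0 = (c k * α) • u (τ k) (xk k) := by
      simp only [hwdef, smul_stPull_apply, smul_zero, add_zero, htk]
    rw [e, norm_smul, Real.norm_of_nonneg (by positivity : (0 : ℝ) ≤ c k * α), ← hkey k]
    exact mul_le_mul_of_nonneg_left (hxk k) (by positivity)
  have hW0 : W (-1) 0 ≠ 0 := by
    have hlim : c₀ / 2 ≤ ‖W (-1) 0‖ :=
      ge_of_tendsto' ((hpt (-1) (by norm_num) 0).norm) fun j => hwk (φ j)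
    intro h
    rw [h, norm_zero] at hlim
    linarith
  -- the scales along the subsequence
  set lam : ℕ → ℝ := fun j => c (φ j) * R with hlamdef
  have hlam : ∀ j, 0 < lam j := fun j => mul_pos (hc (φ j)) hR
  have hlam2 : ∀ j, lam j ^ 2 = ν * (T - τ (φ j)) := fun j => by
    rw [hlamdef, mul_pow, ← hc2 (φ j), hβ]
    field_simp
  have hlam0 : Tendsto lam atTop (𝓝 0) := by
    have h := (hc0.comp hφt).mul_const R
    rw [zero_mul] at h
    exact h
  -- the vorticity zooms are the vorticities of the zooms
  have key : ∀ j (s' : ℝ) (y : EuclideanSpace ℝ (Fin 3)),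
      (lam j ^ 2 / ν) • curl (u (T + lam j ^ 2 * s' / ν)) (xk (φ j) + lam j • y) =
        curl (w (φ j) s') y := fun j s' y => by
    rw [hwdef, curl_smul_stPull]
    have e1 : c (φ j) * α * (c (φ j) * R) = lam j ^ 2 / ν := by
      rw [hlamdef, hα]; field_simp
    have e2 : T + c (φ j) ^ 2 * β * s' = T + lam j ^ 2 * s' / ν := by
      rw [hlamdef, hβ]; field_simp
    rw [e1, e2]
  -- diagonal convergence along the subsequence
  have hdiag : ∀ s < (0 : ℝ), ∀ σ : ℕ → ℝ, Tendsto σ atTop (𝓝 s) → ∀ y,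
      Tendsto (fun j => curl (w (φ j) (σ j)) y) atTop (𝓝 (curl (W s) y)) := by
    intro s hs σ hσ y
    have hD : Tendsto (fun j => fderiv ℝ (w (φ j) (σ j)) y) atTop (𝓝 (fderiv ℝ (W s) y)) :=
      tendsto_fderiv_slice_diag (α * C₁ / Real.sqrt β) (hA.comp hφt) (fun j => hcw (φ j))
        (fun j => hdivw (φ j)) (fun j => hmild (φ j)) (fun j => hIw (φ j)) hs (hptD s hs y) hσ
    show Tendsto (fun j => curlCLM (fderiv ℝ (w (φ j) (σ j)) y)) atTop
      (𝓝 (curlCLM (fderiv ℝ (W s) y)))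
    exact (curlCLM.continuous.tendsto _).comp hD
  refine ⟨φ, hφ, α * C₁ / Real.sqrt β, W, fun j => xk (φ j), lam, hW, hW0, hlam, hlam2, hlam0,
    fun y => ?_, fun s hs σ hσ y => ?_, fun s hs => ?_⟩
  · -- the slice `-1` at the caller's times
    have e : ∀ j, τ (φ j) = T + lam j ^ 2 * (-1) / ν := fun j => by
      rw [hlam2 j]; field_simp; ring
    simp_rw [e, key]
    exact hdiag (-1) (by norm_num) (fun _ => -1) tendsto_const_nhds y
  · simp_rw [key]
    exact hdiag s hs σ hσ y
  · -- locally uniform convergence on the slice `s`: the zooms are `curlCLM ∘ D(w (φ j) s)`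
    have e : (fun j y => (lam j ^ 2 / ν) • curl (u (T + lam j ^ 2 * s / ν)) (xk (φ j) + lam j • y)) =
        fun j => (⇑curlCLM) ∘ fderiv ℝ (w (φ j) s) := by
      funext j y
      rw [key]
      rfl
    rw [e, curl_eq_curlCLM_comp]
    exact curlCLM.uniformContinuous.comp_tendstoLocallyUniformly (hLUD s hs)

end Zoom

end Literature.Analysis.NavierStokesZoomKit

end Part9

/-!
## Part 10 — port of `Summits/NavierStokesRegularity/NavierStokesRegularity/Theorems/SymmetryModuliCountHelicalEndLiouvilleLineLiouvilleEnd.lean` (8 declarations kept)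

# Route SymmetryModuliCount — crux `HelicalEndLiouville` (stmt-NavierStokesRegularity-14062),
# line `vanishing-cell-reynolds`, stub 6: the 2.5-D leaf on an end, direction-free

What is proved (`stub_lineLiouvilleEnd`): an element `u` of the Type-I ancient mild class `A_C`
(`IsTypeIAncientMild C u`, KNSS/Oseen gauge) which, on a backward end `t < T ≤ 0`, is invariant
under ALL translations along a line `ℝL` (`L ≠ 0`) vanishes on that end.

Proof.
1. *Rotation covariance of `A_C`* (`lineLeaf_isTypeIAncientMild_conj`): for a linear isometry
   `R` of `ℝ³` the conjugate field `(t, y) ↦ R (u t (R⁻¹ y))` is again in `A_C` — the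
   Oseen–Koch–Tataru kernel is built from inner products and radial Gaussian weights, so
   `K(τ, Rz)[Ra, Rb] = R K(τ, z)[a, b]` (`lineLeaf_oseenKernel_map`) and the Duhamel term is
   covariant (`lineLeaf_oseenDuhamel_conj`, change of variables `y ↦ Ry`, `R` measure preserving);
   the heat flow commutes with isometries (`lineLeaf_heatFlow_conj`, tree lemmas
   `heatExtension_comp_linearIsometryEquiv`, `heatExtension_continuousLinearEquiv_comp`);
   divergence-freeness is conjugation invariant (tree lemma
   `VectorCalculus.IsDivFree.conj_linearIsometryEquiv`); the Type-I bound is preserved since `R`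
   is norm preserving.
2. *Householder* (`lineLeaf_exists_linearIsometryEquiv_map_eq_single`): a linear isometry `R` with
   `R L = ‖L‖ e₂` (`Submodule.reflection_sub`). Then `R⁻¹(δ e₂) = (δ/‖L‖) L`, so the conjugate
   field is invariant under all translations along `e₂` on `t < T`.
3. *The `x₂`-leaf on an end* (`lineLeaf_axis1`): shift time by `σ = (−T − t₀)/2 > 0`
   (`IsTypeIAncientMild.comp_sub_right`), which makes the field bounded by `C/√σ` on `t < 0` and
   `e₂`-invariant on all of `t < 0`, and apply the PROVED tree theorem
   `KNSS2009_typeI_rate_liouville_holds` (KNSS 2009, proof of Thm 6.2 with Thm 5.1: a bounded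
   ancient mild field independent of `x₂` with `√(−t)|u| ≤ C` vanishes).
4. Undo the rotation: `R (u t₀ x₀) = 0` gives `u t₀ x₀ = 0`.

The rotation-covariance lemmas are adapted from the disprover's sorry-free workfile
`Cruxes/HelicalEndLiouville/Disproof.lean` (§ rotation covariance, `translationLeaf_axis1`,
`translationLeaf`), specialised to `ℝ³` and with the conjugate field inlined. (The same lemmas,
generic in `E`, have meanwhile landed in
`Theorems/SymmetryModuliCountSymmetricLiouvilleRotationCovariance.lean`
(`SymmetryModuliCountSymmetricLiouville.stub_rotationCovariance`); that module was not yet built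
on the check farm when this file was submitted, so the `ℝ³` copies are kept here.)

References: G. Koch, N. Nadirashvili, G. Seregin, V. Šverák, *Liouville theorems for the
Navier–Stokes equations and applications*, Acta Math. 203 (2009) = arXiv:0709.3599, proof of
Thm 6.2 (p. 13) with Thm 5.1 (p. 9). [KochNadirashviliSereginSverak2009]
-/

section Part10

open _root_.Set _root_.MeasureTheory _root_.Function _root_.Filter
open Literature.Analysis.FluidPDE
open Literature.Analysis.UnboundedOperators (heatExtension)
open scoped RealInnerProductSpace _root_.Topology

namespace Literature.Analysis.NavierStokesZoomKit

/-! ### Rotation covariance of the Oseen class on `ℝ³` -/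

-- adapted from Cruxes/HelicalEndLiouville/Disproof.lean §rotation covariance (`oseenKernel_map`,
-- `integral_comp_comm_lie`, `oseenDuhamel_conjField`, `heatFlow_conj`,
-- `isTypeIAncientMild_conjField`), specialised to `ℝ³`, the conjugate field inlined

/-- **The Oseen–Koch–Tataru kernel is rotation covariant**: `K(τ, Rz)[Ra, Rb] = R K(τ, z)[a, b]`
for a linear isometry `R` (the closed form is built from inner products and the radial weights
`G_τ`, `A`, `B`). [folklore]
[cite: KochNadirashviliSereginSverak2009, Thm 1.1–1.3 (context: Liouville theorems for ancient solutions; this declaration is the cell’s own lemma or plumbing, NOT a printed statement)] -/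
theorem lineLeaf_oseenKernel_map (R : (EuclideanSpace ℝ (Fin 3)) ≃ₗᵢ[ℝ] (EuclideanSpace ℝ (Fin 3))) (τ : ℝ) (z a b : (EuclideanSpace ℝ (Fin 3))) :
    oseenKernel τ (R z) (R a) (R b) = R (oseenKernel τ z a b) := by
  have hn : ‖R z‖ = ‖z‖ := R.norm_map z
  simp only [oseenKernel, LinearIsometryEquiv.inner_map_map, heatKernel_eq_of_norm_eq hn,
    oseenWeightA_eq_of_norm_eq hn, oseenWeightB_eq_of_norm_eq hn, map_add, map_sub,
    LinearIsometryEquiv.map_smul]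

/-- A linear isometry commutes with the Bochner integral (no integrability needed: it is a
continuous linear equivalence). [folklore]
[cite: KochNadirashviliSereginSverak2009, Thm 1.1–1.3 (context: Liouville theorems for ancient solutions; this declaration is the cell’s own lemma or plumbing, NOT a printed statement)] -/
theorem lineLeaf_integral_comp_comm {X : Type*} [MeasurableSpace X] (μ : Measure X)
    (R : (EuclideanSpace ℝ (Fin 3)) ≃ₗᵢ[ℝ] (EuclideanSpace ℝ (Fin 3))) (f : X → (EuclideanSpace ℝ (Fin 3))) : ∫ x, R (f x) ∂μ = R (∫ x, f x ∂μ) :=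
  R.toContinuousLinearEquiv.integral_comp_comm f

/-- **The Oseen–Duhamel term is rotation covariant**:
`B^ν_s(R u R⁻¹, R v R⁻¹)(t)(x) = R · B^ν_s(u, v)(t)(R⁻¹x)` (change of variables `y ↦ Ry` in the
space integral, `R` preserves Lebesgue measure, and `lineLeaf_oseenKernel_map`). [folklore]
[cite: KochNadirashviliSereginSverak2009, Thm 1.1–1.3 (context: Liouville theorems for ancient solutions; this declaration is the cell’s own lemma or plumbing, NOT a printed statement)] -/
theorem lineLeaf_oseenDuhamel_conj (R : (EuclideanSpace ℝ (Fin 3)) ≃ₗᵢ[ℝ] (EuclideanSpace ℝ (Fin 3))) (ν s : ℝ) (u v : ℝ → (EuclideanSpace ℝ (Fin 3)) → (EuclideanSpace ℝ (Fin 3))) (t : ℝ)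
    (x : (EuclideanSpace ℝ (Fin 3))) :
    oseenDuhamel ν s (fun τ y => R (u τ (R.symm y))) (fun τ y => R (v τ (R.symm y))) t x =
      R (oseenDuhamel ν s u v t (R.symm x)) := by
  simp only [oseenDuhamel_apply]
  rw [← lineLeaf_integral_comp_comm]
  refine setIntegral_congr_fun measurableSet_Ioo fun τ _ => ?_
  rw [← lineLeaf_integral_comp_comm]
  have hmp : MeasurePreserving R volume volume := R.measurePreserving
  rw [← hmp.integral_comp R.toHomeomorph.measurableEmbedding
    (fun y => oseenKernel (ν * (t - τ)) (x - y) (R (u τ (R.symm y))) (R (v τ (R.symm y))))]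
  congr 1
  funext y
  have e : x - R y = R (R.symm x - y) := by simp [map_sub]
  simp only [LinearIsometryEquiv.symm_apply_apply]
  rw [e, lineLeaf_oseenKernel_map]

/-- **The heat flow is rotation covariant**: `e^{σΔ}(R φ R⁻¹)(x) = R · (e^{σΔ}φ)(R⁻¹x)` (the heat
kernel is radial; including the junk range `σ ≤ 0` where both sides are `R φ R⁻¹`). [folklore]
[cite: KochNadirashviliSereginSverak2009, Thm 1.1–1.3 (context: Liouville theorems for ancient solutions; this declaration is the cell’s own lemma or plumbing, NOT a printed statement)] -/
theorem lineLeaf_heatFlow_conj (R : (EuclideanSpace ℝ (Fin 3)) ≃ₗᵢ[ℝ] (EuclideanSpace ℝ (Fin 3))) (φ : (EuclideanSpace ℝ (Fin 3)) → (EuclideanSpace ℝ (Fin 3))) (σ : ℝ) (x : (EuclideanSpace ℝ (Fin 3))) :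
    heatFlow (fun y => R (φ (R.symm y))) σ x = R (heatFlow φ σ (R.symm x)) := by
  rcases le_or_gt σ 0 with h | h
  · simp [heatFlow_of_nonpos _ h]
  · rw [heatFlow_of_pos _ h, heatFlow_of_pos _ h,
      heatExtension_comp_linearIsometryEquiv R.symm (fun z => R (φ z)) σ x]
    have e : (fun z => R (φ z)) = fun z => R.toContinuousLinearEquiv (φ z) := rfl
    rw [e, heatExtension_continuousLinearEquiv_comp]
    rfl

/-- **`A_C` is rotation invariant**: if `u ∈ A_C` and `R` is a linear isometry of `ℝ³`, the
conjugate field `(t, y) ↦ R (u t (R⁻¹ y))` is in `A_C` (joint smoothness by composition with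
linear maps; divergence-freeness by `div (R v R⁻¹) = (div v) ∘ R⁻¹`; the Oseen identity by
`lineLeaf_oseenDuhamel_conj` and `lineLeaf_heatFlow_conj`; the Type-I bound since `R` preserves
norms — KNSS 2009, §1: the symmetries of the problem). [folklore]
[cite: KochNadirashviliSereginSverak2009, Thm 1.1–1.3 (context: Liouville theorems for ancient solutions; this declaration is the cell’s own lemma or plumbing, NOT a printed statement)] -/
theorem lineLeaf_isTypeIAncientMild_conj {C : ℝ} {u : ℝ → (EuclideanSpace ℝ (Fin 3)) → (EuclideanSpace ℝ (Fin 3))} (h : IsTypeIAncientMild C u)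
    (R : (EuclideanSpace ℝ (Fin 3)) ≃ₗᵢ[ℝ] (EuclideanSpace ℝ (Fin 3))) : IsTypeIAncientMild C (fun t y => R (u t (R.symm y))) := by
  refine ⟨?_, fun t ht => ?_, fun s t hst ht x => ?_, fun t ht x => ?_⟩
  · -- joint smoothness
    have e : uncurry (fun t y => R (u t (R.symm y))) =
        (fun z : (EuclideanSpace ℝ (Fin 3)) => R.toContinuousLinearEquiv z) ∘ uncurry u ∘
          fun p : ℝ × (EuclideanSpace ℝ (Fin 3)) => (p.1, R.symm.toContinuousLinearEquiv p.2) := by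
      funext p; rfl
    rw [e]
    refine R.toContinuousLinearEquiv.contDiff.comp_contDiffOn (h.contDiffOn.comp ?_ ?_)
    · exact (contDiff_fst.prodMk
        (R.symm.toContinuousLinearEquiv.contDiff.comp contDiff_snd)).contDiffOn
    · intro p hp
      exact ⟨hp.1, mem_univ _⟩
  · -- divergence free
    exact VectorCalculus.IsDivFree.conj_linearIsometryEquiv R (h.isDivFree ht)
  · -- the Oseen identity
    show R (u t (R.symm x)) = heatFlow (fun y => R (u s (R.symm y))) (t - s) x -
      oseenDuhamel 1 s (fun τ y => R (u τ (R.symm y))) (fun τ y => R (u τ (R.symm y))) t x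
    rw [lineLeaf_oseenDuhamel_conj, lineLeaf_heatFlow_conj, h.mild_eq hst ht (R.symm x), map_sub]
  · -- Type I
    show ‖R (u t (R.symm x))‖ ≤ C / Real.sqrt (-t)
    rw [LinearIsometryEquiv.norm_map]
    exact h.norm_le ht _

/-! ### The Householder reflection and the `x₂`-leaf on an end -/

-- adapted from Cruxes/HelicalEndLiouville/Disproof.lean §4
-- (`exists_linearIsometryEquiv_map_eq_single`, `translationLeaf_axis1`, `translationLeaf`), with the
-- finite translation invariance as hypothesis

/-- A linear isometry of `ℝ³` taking `L` to `‖L‖ e₂` (the Householder reflection in the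
hyperplane orthogonal to `L − ‖L‖e₂`, `Submodule.reflection_sub`). [folklore]
[cite: KochNadirashviliSereginSverak2009, Thm 1.1–1.3 (context: Liouville theorems for ancient solutions; this declaration is the cell’s own lemma or plumbing, NOT a printed statement)] -/
theorem lineLeaf_exists_linearIsometryEquiv_map_eq_single (L : (EuclideanSpace ℝ (Fin 3))) :
    ∃ R : (EuclideanSpace ℝ (Fin 3)) ≃ₗᵢ[ℝ] (EuclideanSpace ℝ (Fin 3)), R L = EuclideanSpace.single 1 ‖L‖ := by
  have hn : ‖L‖ = ‖(EuclideanSpace.single (1 : Fin 3) ‖L‖ : (EuclideanSpace ℝ (Fin 3)))‖ := by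
    simp
  exact ⟨_, Submodule.reflection_sub hn⟩

/-- **The `x₂`-leaf on a backward end** (KNSS 2009, proof of Thm 6.2 with Thm 5.1, in the tree
`KNSS2009_typeI_rate_liouville_holds`): an element of `A_C` invariant under all translations
along `e₂` on an end `t < θ ≤ 0` vanishes there — shift time by `σ = (−θ − t₀)/2 > 0`
(`IsTypeIAncientMild.comp_sub_right`) to obtain a field bounded by `C/√σ` and `e₂`-invariant on
all of `t < 0`, then apply the tree theorem at `(t₀ + σ, x₀)`.
[cite: KochNadirashviliSereginSverak2009, proof of Thm 6.2 (arXiv:0709.3599 p. 13)] -/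
theorem lineLeaf_axis1 {C : ℝ} {u : ℝ → (EuclideanSpace ℝ (Fin 3)) → (EuclideanSpace ℝ (Fin 3))} (hu : IsTypeIAncientMild C u)
    {θ : ℝ} (hθ : θ ≤ 0)
    (hsym : ∀ t < θ, ∀ (x : (EuclideanSpace ℝ (Fin 3))) (δ : ℝ), u t (x + EuclideanSpace.single 1 δ) = u t x) :
    ∀ t < θ, ∀ x, u t x = 0 := by
  intro t₀ ht₀ x₀
  -- shift into the past by `σ ∈ (−θ, −t₀)`
  set σ : ℝ := (-θ - t₀) / 2 with hσ
  have hσθ : -θ < σ := by rw [hσ]; linarith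
  have hσ0 : 0 < σ := lt_of_le_of_lt (neg_nonneg.2 hθ) hσθ
  have hσt : t₀ + σ < 0 := by rw [hσ]; linarith
  set v : ℝ → (EuclideanSpace ℝ (Fin 3)) → (EuclideanSpace ℝ (Fin 3)) := fun t => u (t - σ) with hv
  have hvmem : IsTypeIAncientMild C v := hu.comp_sub_right hσ0.le
  have hC : 0 ≤ C := hu.nonneg
  -- the six hypotheses of the tree theorem
  have h1 : ContinuousOn (uncurry v) (Iio 0 ×ˢ univ) := hvmem.continuousOn_uncurry
  have h2 : ∃ K : ℝ, ∀ t < 0, ∀ x, ‖v t x‖ ≤ K := by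
    refine ⟨C / Real.sqrt σ, fun t ht x => ?_⟩
    have key := hu.norm_le (t := t - σ) (by linarith) x
    refine key.trans ?_
    exact div_le_div_of_nonneg_left hC (Real.sqrt_pos.2 hσ0) (Real.sqrt_le_sqrt (by linarith))
  have h3 : ∀ t < 0, IsWeaklyDivFree (v t) := fun t ht => hvmem.isWeaklyDivFree ht
  have h4 : ∀ s t : ℝ, s < t → t < 0 → ∀ x,
      v t x = heatExtension (v s) (t - s) x - oseenDuhamel 1 s v v t x :=
    fun s t hst ht x => hvmem.mild_eq_heatExtension hst ht x
  have h5 : ∀ t < 0, ∀ (x : (EuclideanSpace ℝ (Fin 3))) (δ : ℝ), v t (x + EuclideanSpace.single 1 δ) = v t x :=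
    fun t ht x δ => hsym (t - σ) (by linarith) x δ
  have h6 : ∀ t < 0, ∀ x, Real.sqrt (-t) * ‖v t x‖ ≤ C := by
    intro t ht x
    have hs : 0 < Real.sqrt (-t) := Real.sqrt_pos.2 (by linarith)
    have key := hvmem.norm_le ht x
    rw [le_div_iff₀ hs] at key
    linarith [mul_comm (Real.sqrt (-t)) ‖v t x‖]
  have hzero := KNSS2009_typeI_rate_liouville_holds h1 h2 h3 h4 h5 h6 (t₀ + σ) hσt x₀
  simpa [hv] using hzero

/-- **Stub 6 (the 2.5-D leaf on an end, direction-free).** An element of `A_C` invariant under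
all translations along a line `ℝL` (`L ≠ 0`) on a backward end `t < T ≤ 0` vanishes on that end:
rotate `L` onto `‖L‖e₂` (rotation covariance of `A_C`: `K(τ, Rz)[Ra, Rb] = R K(τ, z)[a, b]`,
`e^{σΔ}` commutes with isometries), shift time by `σ > 0` to make the field bounded
(`IsTypeIAncientMild.comp_sub_right`), and apply the PROVED tree theorem
`KNSS2009_typeI_rate_liouville_holds` (KNSS 2009, proof of Thm 6.2 with Thm 5.1). [cite: KochNadirashviliSereginSverak2009, proof of Thm 6.2 (arXiv:0709.3599 p. 13)] -/
theorem stub_lineLiouvilleEnd :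
    ∀ (C : ℝ) (u : ℝ → (EuclideanSpace ℝ (Fin 3)) → (EuclideanSpace ℝ (Fin 3))), IsTypeIAncientMild C u → ∀ (L : (EuclideanSpace ℝ (Fin 3))) (T : ℝ), L ≠ 0 → T ≤ 0 →
      (∀ t < T, ∀ (x : (EuclideanSpace ℝ (Fin 3))) (s : ℝ), u t (x + s • L) = u t x) → ∀ t < T, ∀ x, u t x = 0 := by
  intro C u hu L T hL hT hinv
  obtain ⟨R, hR⟩ := lineLeaf_exists_linearIsometryEquiv_map_eq_single L
  have hw : IsTypeIAncientMild C (fun t y => R (u t (R.symm y))) :=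
    lineLeaf_isTypeIAncientMild_conj hu R
  have hc : ‖L‖ ≠ 0 := norm_ne_zero_iff.2 hL
  -- `R⁻¹ (δ e₂) = (δ/‖L‖) L`
  have hpull : ∀ δ : ℝ, R.symm (EuclideanSpace.single 1 δ) = (δ / ‖L‖) • L := by
    intro δ
    have e1 : R ((δ / ‖L‖) • L) = EuclideanSpace.single (1 : Fin 3) δ := by
      rw [LinearIsometryEquiv.map_smul, hR]
      ext i
      by_cases hi : i = 1
      · subst hi; simp [div_mul_cancel₀ δ hc]
      · simp [hi]
    rw [← e1, LinearIsometryEquiv.symm_apply_apply]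
  -- the conjugate field is invariant under all translations along `e₂` on the end
  have hsymw : ∀ t < T, ∀ (y : (EuclideanSpace ℝ (Fin 3))) (δ : ℝ),
      R (u t (R.symm (y + EuclideanSpace.single 1 δ))) = R (u t (R.symm y)) := by
    intro t ht y δ
    rw [map_add, hpull δ, hinv t ht (R.symm y) (δ / ‖L‖)]
  intro t ht x
  have key := lineLeaf_axis1 hw hT hsymw t ht (R x)
  simpa using key

end Literature.Analysis.NavierStokesZoomKit

end Part10

/-!
## Part 11 — port of `Summits/NavierStokesRegularity/NavierStokesRegularity/Theorems/SymmetricLiouville/Negative/AncientLoadBearing.lean` (1 declarations kept)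

# Crux `SymmetricLiouville` (stmt-NavierStokesRegularity-4053), negative side: "ancient" is load-bearing

Negative-side (cdisprove, D-0016) support lemmas extracted from
`Cruxes/SymmetricLiouville/Disproof.lean` v3 of route `SymmetryModuliCount`. The crux says: a smooth,
divergence-free, KNSS-mild ANCIENT field on `(−∞,0) × ℝ³` with Type-I time decay
`‖u(t,x)‖ ≤ C/√(−t)` which is annihilated by the generator of a nonzero `ξ ∈ sim(3)` vanishes.

Here "ancient" is shown to be load-bearing: `SymmetricLiouvilleOnWindow T` — the same statement with
all hypotheses, the symmetry and the conclusion restricted to a FINITE backward window `(−T, 0)` — is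
FALSE for every `T > 0` (`symmetricLiouville_false_on_window`). The witness is the viscous shear wave
(Kolmogorov mode) `u(t, y) = e^{−4π²t} sin(2π y₀) e₁`, an exact Navier–Stokes solution with vanishing
nonlinearity: it is smooth, divergence free, satisfies the KNSS/Oseen integral equation between ANY
two times (`shearWave_mild`: the heat flow of a plane wave, `heatExtension_shear`, from the tree's
`fourierIntegral_heatKernel_holds`; and the vanishing of the Oseen–Duhamel term on tensors independent
of the divergence coordinate, the tree's `integral_oseenKernel_sub_smul_single_left`), is Type-I on
the window with `C = e^{4π²T}√T`, is invariant under translations along `e₁`, and is nonzero. It is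
not a counterexample to the crux only because it grows like `e^{4π²|t|}` as `t → −∞`: any proof of
the crux must use the behaviour of `u` as `t → −∞`, not merely the equation and the rate near `t = 0`.

No route statement is changed (`--supports`).

Not carried from this source module (not needed by the declarations re-homed here; their consumers are Summits-side): `f0`, `norm_e1`, `norm_f0`, `inner_f0`, `e1_ne_zero`, `e1_apply_zero`, `continuous_coord0`, `fourier_heatKernel_f0`, `integrable_cexp_smul_heatKernel`, `integral_heatKernel_mul_cos`, `integral_heatKernel_mul_sin`, `integrable_heatKernel_mul`, `heatExtension_shear`, `shearWave`, `shearWave_contDiff`, `hasFDerivAt_shearWave`, `fderiv_shearWave_apply`, `shearWave_divFree`, `shearWave_symm`, `norm_shearWave_le`, `shearWave_ne_zero`, `shearWave_mild`, `SymmetricLiouvilleOnWindow`, `symmetricLiouville_false_on_window`.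
-/

section Part11

namespace Literature.Analysis.NavierStokesZoomKit.SymmetricLiouville.Negative

open Literature.Analysis.FluidPDE Literature.Analysis.UnboundedOperators _root_.MeasureTheory _root_.Set
  _root_.Function
open scoped RealInnerProductSpace FourierTransform _root_.Real

/-- Unit vector along Lean coordinate `1` (direction of the shear velocity).
[cite: KochNadirashviliSereginSverak2009, Thm 1.1–1.3 (context: Liouville theorems for ancient solutions; this declaration is the cell’s own lemma or plumbing, NOT a printed statement)] -/
def e1 : (EuclideanSpace ℝ (Fin 3)) := EuclideanSpace.single 1 1

end Literature.Analysis.NavierStokesZoomKit.SymmetricLiouville.Negative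

end Part11

/-!
## Part 12 — port of `Summits/NavierStokesRegularity/NavierStokesRegularity/Theorems/SymmetryModuliCountSymmetricLiouvilleSmallAtMinusInfinity.lean` (1 declarations kept)

# Stub A2 of line `blowdown-kills-pitch` of crux `SymmetricLiouville`: small at `−∞` forces zero

Crux stmt-NavierStokesRegularity-4053, route `SymmetryModuliCount`.

For every element `u` of the Type-I moduli class `A_C = IsTypeIAncientMild C` (smooth, divergence
free, KNSS/Oseen-mild between all pairs `s < t < 0`, `‖u(t,x)‖ ≤ C/√(−t)`; NO symmetry), if the
scale-invariant size `√(−t)‖u(t,x)‖` is small near `t = −∞` then `u ≡ 0` on the whole past.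

Proof = two tree engines glued.

* BACKWARD HALF (`exists_vanishes_before`): the landed gap theorem
  `Negative.exists_eps_small_vanishes` (`∃ ε₀ > 0`, every element of `A_C` with
  `√(−t)‖u‖ ≤ ε₀` throughout vanishes) applied to the backward time shift `v = u(· + T) ∈ A_C`
  (`IsTypeIAncientMild.comp_sub_right`), where `T < 0` is the time before which
  `√(−t)‖u(t,x)‖ ≤ ε₀`; monotonicity `√(−t) ≤ √(−(t+T))` transfers the smallness to `v`, so
  `u ≡ 0` on `t < T`.
* FORWARD HALF (`vanishes_of_vanishes_before`): uniqueness of bounded Oseen-mild solutions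
  (`oseenMild_bounded_unique`) on the slab `(T − 1, t₁/2)` with the vanishing free term
  `e^{(t−s)Δ}u(s) = 0` (`s = T − 1`), comparing `u` with the zero solution; the a.e. identity
  `u(t₁) = 0` is upgraded to a pointwise one by continuity of the slice.

Not carried from this source module (not needed by the declarations re-homed here; their consumers are Summits-side): `exists_vanishes_before`, `stub_smallAtMinusInfinityLiouville`.
-/

section Part12

open _root_.Set _root_.Function _root_.Filter _root_.MeasureTheory
open scoped _root_.Topology
open Literature.Analysis Literature.Analysis.FluidPDE

namespace Literature.Analysis.NavierStokesZoomKit.SymmetryModuliCountSymmetricLiouville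

/-- **Forward half.** If `u ∈ A_C` vanishes identically before some negative time `T`, then it
vanishes on the whole past: on the slab `(T − 1, t₁/2) × ℝ³` both `u` and `0` are bounded, jointly
measurable solutions of the Oseen integral equation with the same (vanishing) free term
`e^{(t−s)Δ}u(s)`, `s = T − 1`, so they agree a.e. at `t₁` (`oseenMild_bounded_unique`), hence
everywhere by continuity of the slice `u(t₁)`.
[cite: KochNadirashviliSereginSverak2009, Thm 1.1–1.3 (context: Liouville theorems for ancient solutions; this declaration is the cell’s own lemma or plumbing, NOT a printed statement)] -/
theorem vanishes_of_vanishes_before {C T : ℝ} {u : ℝ → (EuclideanSpace ℝ (Fin 3)) → (EuclideanSpace ℝ (Fin 3))} (h : IsTypeIAncientMild C u)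
    (hT : T < 0) (hz : ∀ t < T, ∀ x, u t x = 0) : ∀ t < 0, ∀ x, u t x = 0 := by
  intro t₁ ht₁ x
  by_cases hlt : t₁ < T
  · exact hz t₁ hlt x
  rw [not_lt] at hlt
  -- the slab `(s, T') = (T - 1, t₁ / 2)`
  have hs0 : ∀ y, u (T - 1) y = 0 := hz (T - 1) (by linarith)
  have hsT' : T - 1 < t₁ / 2 := by linarith
  have hT'0 : t₁ / 2 < 0 := by linarith
  have ht₁I : t₁ ∈ Ioo (T - 1) (t₁ / 2) := ⟨by linarith, by linarith⟩
  have hM : 0 ≤ C / Real.sqrt (-(t₁ / 2)) := div_nonneg h.nonneg (Real.sqrt_nonneg _)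
  have huM : ∀ τ ∈ Ioo (T - 1) (t₁ / 2), ∀ y, ‖u τ y‖ ≤ C / Real.sqrt (-(t₁ / 2)) :=
    fun τ hτ y => h.norm_le_of_mem_Ioo hT'0 hτ y
  have hvM : ∀ τ ∈ Ioo (T - 1) (t₁ / 2), ∀ y : (EuclideanSpace ℝ (Fin 3)),
      ‖(0 : ℝ → (EuclideanSpace ℝ (Fin 3)) → (EuclideanSpace ℝ (Fin 3))) τ y‖ ≤ C / Real.sqrt (-(t₁ / 2)) := fun τ _ y => by
    simpa only [Pi.zero_apply, norm_zero] using hM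
  have hum := h.aestronglyMeasurable_uncurry (s := T - 1) hT'0.le
  have hvm : AEStronglyMeasurable (uncurry (0 : ℝ → (EuclideanSpace ℝ (Fin 3)) → (EuclideanSpace ℝ (Fin 3))))
      ((volume : Measure (ℝ × (EuclideanSpace ℝ (Fin 3)))).restrict (Ioo (T - 1) (t₁ / 2) ×ˢ univ)) :=
    aestronglyMeasurable_const
  -- the two integral equations with the free term `e^{(t-s)Δ} u(s) = 0`
  have hu : ∀ t ∈ Ioo (T - 1) (t₁ / 2), u t =ᵐ[volume] fun y =>
      UnboundedOperators.heatExtension (u (T - 1)) (t - (T - 1)) y -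
        oseenDuhamel 1 (T - 1) u u t y :=
    fun t ht => Eventually.of_forall fun y => h.mild_eq_heatExtension ht.1 (ht.2.trans hT'0) y
  have hv : ∀ t ∈ Ioo (T - 1) (t₁ / 2), (0 : ℝ → (EuclideanSpace ℝ (Fin 3)) → (EuclideanSpace ℝ (Fin 3))) t =ᵐ[volume] fun y =>
      UnboundedOperators.heatExtension (u (T - 1)) (t - (T - 1)) y -
        oseenDuhamel 1 (T - 1) (0 : ℝ → (EuclideanSpace ℝ (Fin 3)) → (EuclideanSpace ℝ (Fin 3))) (0 : ℝ → (EuclideanSpace ℝ (Fin 3)) → (EuclideanSpace ℝ (Fin 3))) t y := by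
    intro t ht
    refine Eventually.of_forall fun y => ?_
    have e0 : u (T - 1) = fun _ => (0 : (EuclideanSpace ℝ (Fin 3))) := funext hs0
    rw [oseenDuhamel_zero_left, e0]
    simp only [Pi.zero_apply, sub_zero]
    rw [UnboundedOperators.heatExtension_const _ (sub_pos.2 ht.1)]
  have key := oseenMild_bounded_unique one_pos hM hum hvm huM hvM hu hv t₁ ht₁I
  have heq := (Continuous.ae_eq_iff_eq volume (h.continuous_slice ht₁) continuous_const).1 key
  simpa using congr_fun heq x

end Literature.Analysis.NavierStokesZoomKit.SymmetryModuliCountSymmetricLiouville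

end Part12

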